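import Literature.MathematicalPhysics.QuantumLattice.StrongCouplingSUNBaryonDeterminant
import HarnessLib

/-!
# The Schwinger–Dyson lower bound for `SU(N)`, `N` odd `≥ 3`, at `β = 0`: the `N`-fold dimers at a site
# dominate the baryon loops of length `≥ 4` through it

Continuation of `StrongCouplingSUNBaryonDeterminant` (the Pfaffian structure theorem for the `β = 0`,
`m = 0` `SU(N)` lattice gauge theory with one staggered flavour: `σ_Λ Z = (N!)^{|Λ|} ∑_{n adm} W(n)`,
`W(n) = w(n) (N!)^{-|S(n)|} det K̃_{S(n)} ≥ 0`, and the exact per-bond Schwinger–Dyson decomposition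
`sd_bond_eq_topDimer`).  This file proves the SCHWINGER–DYSON LOWER BOUND FOR `SU(N)`, `N` ODD `≥ 3`
(`sd_site_lower_bound_SU`): on any finite SIMPLE BIPARTITE link set with distinct endpoints and signs
`Γ_b = ±1`, for every site `x`,

  `4N · σ_Λ Z ≤ ∑_{b ∋ x} σ_Λ ∫ e^{-S_F} ψ̄ψ(x_b) ψ̄ψ(y_b)`,   i.e.  `∑_{y∼x} ⟨ψ̄ψ(x)ψ̄ψ(y)⟩_Λ ≥ 4N` if `Z ≠ 0`

(`sum_nbr_fermiExpectSU_ge`).  In Salmhofer–Seiler's units `σ = ψ̄ψ/2N` this is `∑_{y∼x}⟨σ_xσ_y⟩_Λ ≥ 1/N` —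
their Lemma 4.7 / (4.38) (CMP 139 (1991), for `U(N)`, with the constant `K(N)`) with `K(N)` replaced by
`N`, now for `SU(N)` in spite of the baryon loops of the monomer–dimer–polymer representation
(Rossi–Wolff; Karsch–Mütter; Fromm–de Forcrand (4)–(7)); it is the Schwinger–Dyson input of their
Theorem 4.8 (chiral long-range order, given the infrared bound) and the estimate their §5, p. 424, leaves
open for `SU(N)`.  It fails for `SU(2)`.

Steps.  (1) `sum_twoCycle_eq`: at an untouched site `x` the `2`-cycles of the cycle expansion
`det_Kred_eq_sum_cycle` are in bijection with the links at `x` whose far endpoint is untouched (simple link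
set), each contributing `4^{-N} det K̃` of the pattern with the link saturated; hence
(`baryonic_eq_twoCycle_add_longLoops`) the baryonic weight at `x` is the `N`-fold-dimer part — which the
second sum of `sd_bond_eq_topDimer` reproduces with the factor `4N` — plus the signed LONG LOOPS through `x`
(`longLoops`, cyclic `z` through `x` with `|supp z| ≠ 2`).  (2) `sum_nbr_sdCoeff_ge`: the mesonic part
`∑_{b∋x}∑_{adm} 4n_b(N+1-n_b)W(n)` is `≥ 8N ×` the dimer weight at `x` (`n_b ≤ N-1`).  (3) THE DIMER
WEIGHT AT `x` DOMINATES THE LONG LOOPS (`longLoops_le_dimer`): a long loop `z` through `x` hopping along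
links has even length `2k ≥ 4` (bipartite: `card_support_eq_two_mul`) and its term has modulus
`4^{-Nk} det K̃[S ∖ supp z]` with `det K̃[S ∖ supp z] ≥ 0` (`sign_mul_prod_Kred_real`, `det_submatrix_loop_eq`);
CLOSING THE LOOP WITH THE ALTERNATING PATTERN `1, N-1, 1, N-1, …` of partial dimers (`patVal`, `patCfg`)
gives an admissible configuration in which exactly the loop sites have become saturated (`siteDeg_patCfg`),
of weight EXACTLY `w(n)(N!)^{-|S|} 4^{-Nk} det K̃[S ∖ supp z]` (`zWeight_patCfg`, from
`c_1 c_{N-1} (N!)² = 4^{-N}`, `dimerCoeff_one_mul_pred`, and the colour balance of the loop,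
`card_filter_color_support`), and the map `(n, z) ↦ n'` is injective (`patCfg_injOn`: the loop is read back
from `n'` by following, from `x`, the links carrying the pattern value of the current site —
`patCfg_eq_patVal_iff`; here `N ≥ 3` enters through `1 ≠ N - 1`).  (4) Assembly: `∑_{b∋x} σ∫ =
(N!)^{|Λ|}[A + 4N·(Bar_x - LT_x)] ≥ (N!)^{|Λ|}[8N·Dim_x + 4N·Bar_x - 4N·Dim_x] = 4N·σ_Λ Z`.  Finally
`Z(m = 0) > 0` as soon as one admissible configuration saturates every site (`sgn_mul_fermiZSU_zero_pos_of_saturating`;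
e.g. `N-1` dimers on a perfect matching and `1` on a disjoint one), whence the unconditional expectation
form `sum_nbr_fermiExpectSU_ge_of_saturating`; and the STAGGERED TORUS `(ℤ/Lℤ)^ν` (links `(x, x+e_μ)`,
`torusLinks`) is simple for `L ≥ 3` (`torusLinks_simple`), bipartite for `L` even (`torusLinks_bipartite`,
colouring by `ComplexSpin.parity`) and saturable for `ν ≥ 1`, `L` even (`exists_saturating_torusLinks`: `N-1`
dimers on the links `(y, y+e_0)` with `y` even, `1` on those with `y` odd), whence `Z > 0`
(`sgn_mul_fermiZSU_zero_pos_torus`) and THE BOUND ON THE TORUS `sum_nbr_fermiExpectSU_ge_torus`: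
`∑_{b∋x} ⟨ψ̄ψ(x_b)ψ̄ψ(y_b)⟩_Λ ≥ 4N` for `N` odd `≥ 3`, `ν ≥ 1`, `L` even `≥ 4`, any signs `Γ_b = ±1`.

Honest framing: `β = 0`, `m = 0`, finite volume, one staggered flavour, `N` odd `≥ 3`, finite simple
bipartite link sets with distinct endpoints and `Γ_b = ±1` (e.g. the staggered even torus of side `≥ 4` with
arbitrary sign twists for the boundary conditions); a finite-volume correlation inequality — nothing about
`β > 0`, `μ ≠ 0`, the infrared bound, chiral symmetry breaking, the thermodynamic limit or the continuum.
The patterned-loop comparison is this tree's re-organisation of the monomer–dimer–polymer bookkeeping of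
Fromm–de Forcrand (6) (not located in print); statements are proved theorems citing the sources of the
objects they are about.

## References

* M. Salmhofer, E. Seiler, Commun. Math. Phys. 139 (1991) 395, Lemma 4.7 (4.38), Thm 4.8, §5 p. 424. [SalmhoferSeiler1991]
* M. Fromm, Ph. de Forcrand, arXiv:0811.1931, (4)–(7) p. 3. [FrommForcrand2008]
* P. Rossi, U. Wolff, Nucl. Phys. B 248 (1984) 105. [RossiWolff1984]
* A. Cayley, J. reine angew. Math. 38 (1849) 93–96 (`det = Pf²`). [Cayley1849]
* D. M. Cvetković, M. Doob, H. Sachs, *Spectra of Graphs* (1980), §1.4 Thm 1.2 & (1.35*); N. Biggs, *Algebraic Graph Theory* (1974), Prop. 7.2. [CvetkovicDoobSachs1980] [Biggs1974]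
-/


noncomputable section

namespace Literature.MathematicalPhysics.QuantumLattice

namespace StrongCoupling

open GrassmannAlgebra Matrix

/-! ### The `2`-cycle part of the baryonic weight at `x` (simple link sets) -/

section TwoCycles

variable {Λ : Type*} [LinearOrder Λ] [Fintype Λ] {N : ℕ}
variable {B : Type*} [Fintype B] [DecidableEq B]

/-- The link `b` joins the sites `u` and `v` (in either orientation). [cite: FrommForcrand2008, (6)] -/
abbrev Joins (l : B → Λ × Λ) (b : B) (u v : Λ) : Prop :=
  ((l b).1 = u ∧ (l b).2 = v) ∨ ((l b).1 = v ∧ (l b).2 = u)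

/-- Adjacency of two sites in the link set. [cite: FrommForcrand2008, (6)] -/
abbrev Adj (l : B → Λ × Λ) (u v : Λ) : Prop := ∃ b, Joins l b u v

omit [LinearOrder Λ] [Fintype Λ] [Fintype B] [DecidableEq B] in
/-- `Joins` is symmetric in the two sites. [cite: FrommForcrand2008, (6)] -/
theorem joins_comm {l : B → Λ × Λ} {b : B} {u v : Λ} : Joins l b u v ↔ Joins l b v u := Or.comm

omit [LinearOrder Λ] [Fintype Λ] [Fintype B] [DecidableEq B] in
/-- Adjacency is symmetric. [cite: FrommForcrand2008, (6)] -/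
theorem adj_comm {l : B → Λ × Λ} {u v : Λ} : Adj l u v ↔ Adj l v u :=
  ⟨fun ⟨b, hb⟩ => ⟨b, joins_comm.1 hb⟩, fun ⟨b, hb⟩ => ⟨b, joins_comm.1 hb⟩⟩

omit [LinearOrder Λ] [Fintype Λ] [Fintype B] [DecidableEq B] in
/-- Adjacent sites are distinct (distinct endpoints). [cite: FrommForcrand2008, (6)] -/
theorem Adj.ne {l : B → Λ × Λ} (hl : ∀ b, (l b).1 ≠ (l b).2) {u v : Λ} (h : Adj l u v) : u ≠ v := by
  obtain ⟨b, ⟨h1, h2⟩ | ⟨h1, h2⟩⟩ := h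
  · exact fun huv => hl b (h1.trans (huv.trans h2.symm))
  · exact fun huv => hl b (h1.trans (huv.symm.trans h2.symm))

omit [LinearOrder Λ] [Fintype Λ] [Fintype B] [DecidableEq B] in
/-- In a bipartite link set adjacent sites have different colours. [cite: SalmhoferSeiler1991, §2 (2.4)] -/
theorem Adj.color_ne {l : B → Λ × Λ} {ε : Λ → Bool} (hε : ∀ b, ε (l b).1 ≠ ε (l b).2) {u v : Λ} (h : Adj l u v) :
    ε u ≠ ε v := by
  obtain ⟨b, ⟨h1, h2⟩ | ⟨h1, h2⟩⟩ := h
  · rw [← h1, ← h2]; exact hε b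
  · rw [← h1, ← h2]; exact (hε b).symm

omit [LinearOrder Λ] [Fintype Λ] [Fintype B] [DecidableEq B] in
/-- A link joins its endpoints. [cite: FrommForcrand2008, (6)] -/
theorem joins_self (l : B → Λ × Λ) (b : B) : Joins l b (l b).1 (l b).2 := Or.inl ⟨rfl, rfl⟩

variable (N) in
/-- **The term of one oriented baryon loop** `z` through an untouched site in the cycle expansion
`det_Kred_eq_sum_cycle` of the baryon determinant: `sgn z · ∏_{i ∈ supp z} K̃_{z(i) i} · det K̃[S ∖ supp z]`. [cite: FrommForcrand2008, (6)] -/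
def cycTerm (l : B → Λ × Λ) (Γ : B → ℂ) (D : Λ → ℕ) (z : Equiv.Perm (Free D)) : ℂ :=
  ((Equiv.Perm.sign z : ℤ) : ℂ) * (∏ i ∈ z.support, Kred N l Γ D (z i) i) *
    ((Kred N l Γ D).submatrix (Subtype.val : {u // u ∉ z.support} → Free D) Subtype.val).det

omit [DecidableEq B] in
/-- `det K̃_S = ∑_{z cyclic through v} cycTerm z` (`N` odd). [cite: FrommForcrand2008, (6)] [cite: CvetkovicDoobSachs1980, §1.4 Thm 1.2 & (1.35*)] -/
theorem det_Kred_eq_sum_cycTerm (hN : Odd N) (l : B → Λ × Λ) (Γ : B → ℂ) (D : Λ → ℕ) (v : Free D) :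
    (Kred N l Γ D).det =
      ∑ z ∈ Finset.univ.filter (fun z : Equiv.Perm (Free D) => z.cycleOf v = z ∧ z v ≠ v), cycTerm N l Γ D z :=
  det_Kred_eq_sum_cycle hN l Γ D v

/-! #### The `2`-cycles through `v` are the transpositions `(v u)` -/

omit [Fintype B] [DecidableEq B] in
/-- The cyclic permutations through `v` with two-element support are the transpositions `(v u)`, `u ≠ v`. [cite: Biggs1974, Proposition 7.2] -/
theorem filter_twoCycle_eq_image {D : Λ → ℕ} (v : Free D) :
    Finset.univ.filter (fun z : Equiv.Perm (Free D) => (z.cycleOf v = z ∧ z v ≠ v) ∧ z.support.card = 2) =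
      (Finset.univ.filter (fun u : Free D => u ≠ v)).image (fun u => Equiv.swap v u) := by
  ext z
  simp only [Finset.mem_filter, Finset.mem_univ, true_and, Finset.mem_image]
  constructor
  · rintro ⟨⟨-, hv⟩, h2⟩
    obtain ⟨a, c, hac, rfl⟩ := Equiv.Perm.card_support_eq_two.1 h2
    by_cases hva : v = a
    · subst hva
      exact ⟨c, hac.symm, rfl⟩
    · by_cases hvc : v = c
      · subst hvc
        exact ⟨a, hac, Equiv.swap_comm v a⟩
      · exact absurd (Equiv.swap_apply_of_ne_of_ne hva hvc) hv
  · rintro ⟨u, hu, rfl⟩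
    exact ⟨swap_mem_cycles hu.symm, Equiv.Perm.card_support_swap hu.symm⟩

omit [Fintype B] [DecidableEq B] in
/-- `u ↦ (v u)` is injective. [cite: Biggs1974, Proposition 7.2] -/
theorem swap_injOn {D : Λ → ℕ} (v : Free D) :
    Set.InjOn (fun u : Free D => Equiv.swap v u) ↑(Finset.univ.filter (fun u : Free D => u ≠ v)) := by
  intro u _ u' _ h
  have h' := congrArg (fun z : Equiv.Perm (Free D) => z v) h
  simpa only [Equiv.swap_apply_left] using h'

omit [DecidableEq B] in
/-- The `2`-cycle part of the cycle expansion as a sum over the other endpoint. [cite: FrommForcrand2008, (6)] -/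
theorem sum_twoCycle_eq_sum_swap (l : B → Λ × Λ) (Γ : B → ℂ) {D : Λ → ℕ} (v : Free D) :
    ∑ z ∈ Finset.univ.filter (fun z : Equiv.Perm (Free D) => (z.cycleOf v = z ∧ z v ≠ v) ∧ z.support.card = 2),
        cycTerm N l Γ D z =
      ∑ u ∈ Finset.univ.filter (fun u : Free D => u ≠ v), cycTerm N l Γ D (Equiv.swap v u) := by
  rw [filter_twoCycle_eq_image v, Finset.sum_image (swap_injOn v)]

omit [DecidableEq B] in
/-- A transposition `(v u)` of NON-adjacent untouched sites contributes nothing (`K̃_{uv} = 0`). [cite: FrommForcrand2008, (5)–(6)] -/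
theorem cycTerm_swap_eq_zero_of_not_adj (l : B → Λ × Λ) (Γ : B → ℂ) {D : Λ → ℕ} {v u : Free D} (h : v ≠ u)
    (hna : ¬Adj l v.1 u.1) : cycTerm N l Γ D (Equiv.swap v u) = 0 := by
  have h0 : Kred N l Γ D u v = 0 :=
    Kred_apply_eq_zero_of_not_adj l Γ D u v fun b =>
      ⟨fun hb => hna ⟨b, Or.inr hb⟩, fun hb => hna ⟨b, Or.inl hb⟩⟩
  rw [cycTerm, sign_mul_prod_swap l Γ h, h0, zero_mul, neg_zero, zero_mul]

omit [DecidableEq B] in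
/-- **The transposition `(v u)` of adjacent untouched sites is the `N`-fold dimer**: with `b` the unique
link joining them (`Γ_b = ±1`, `N` odd), `cycTerm (v u) = 4^{-N} det K̃_{S(D + N·e_b)}` (first endpoint
`v`). [cite: FrommForcrand2008, (5)–(6)] -/
theorem cycTerm_swap_eq_of_fst (hN : Odd N) (l : B → Λ × Λ) (Γ : B → ℂ) {D : Λ → ℕ} {v u : Free D} (h : v ≠ u)
    (b : B) (hv : v.1 = (l b).1) (hu : u.1 = (l b).2) (huniq : ∀ b', Joins l b' (l b).1 (l b).2 → b' = b)
    (hΓ : Γ b = 1 ∨ Γ b = -1) :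
    cycTerm N l Γ D (Equiv.swap v u) = ((4 : ℂ)⁻¹) ^ N * (Kred N l Γ (fun y => D y + N * bondObs l b y)).det := by
  have hb : ((l b).1 = u.1 ∧ (l b).2 = v.1) ∨ ((l b).1 = v.1 ∧ (l b).2 = u.1) := Or.inr ⟨hv.symm, hu.symm⟩
  have huniq' : ∀ b', (((l b').1 = u.1 ∧ (l b').2 = v.1) ∨ ((l b').1 = v.1 ∧ (l b').2 = u.1)) → b' = b :=
    fun b' hb' => huniq b' (by
      rcases hb' with ⟨h1, h2⟩ | ⟨h1, h2⟩
      · exact Or.inr ⟨h1.trans hu, h2.trans hv⟩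
      · exact Or.inl ⟨h1.trans hv, h2.trans hu⟩)
  rw [cycTerm, swap_term_eq hN l Γ h b hb huniq' hΓ, det_submatrix_swap_eq hN.pos l Γ b D v u hv hu h]

omit [DecidableEq B] in
/-- The same for either orientation of the joining link. [cite: FrommForcrand2008, (5)–(6)] -/
theorem cycTerm_swap_eq (hN : Odd N) (l : B → Λ × Λ) (Γ : B → ℂ) {D : Λ → ℕ} {v u : Free D} (h : v ≠ u)
    (b : B) (hj : Joins l b v.1 u.1) (huniq : ∀ b', Joins l b' (l b).1 (l b).2 → b' = b)
    (hΓ : Γ b = 1 ∨ Γ b = -1) :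
    cycTerm N l Γ D (Equiv.swap v u) = ((4 : ℂ)⁻¹) ^ N * (Kred N l Γ (fun y => D y + N * bondObs l b y)).det := by
  rcases hj with ⟨h1, h2⟩ | ⟨h1, h2⟩
  · exact cycTerm_swap_eq_of_fst hN l Γ h b h1.symm h2.symm huniq hΓ
  · rw [Equiv.swap_comm]
    exact cycTerm_swap_eq_of_fst hN l Γ h.symm b h1.symm h2.symm huniq hΓ

/-- The far endpoint of a link at `x`. [cite: FrommForcrand2008, (6)] -/
def far (l : B → Λ × Λ) (b : B) (x : Λ) : Λ := if (l b).1 = x then (l b).2 else (l b).1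

omit [Fintype Λ] [Fintype B] [DecidableEq B] in
/-- A link at `x` joins `x` to its far endpoint. [cite: FrommForcrand2008, (6)] -/
theorem joins_far (l : B → Λ × Λ) (b : B) {x : Λ} (hb : (l b).1 = x ∨ (l b).2 = x) : Joins l b x (far l b x) := by
  unfold far
  split_ifs with h1
  · exact Or.inl ⟨h1, rfl⟩
  · rcases hb with h | h
    · exact absurd h h1
    · exact Or.inr ⟨rfl, h⟩

omit [Fintype Λ] [Fintype B] [DecidableEq B] in
/-- The far endpoint is determined by the joining relation (distinct endpoints). [cite: FrommForcrand2008, (6)] -/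
theorem far_eq_of_joins (l : B → Λ × Λ) (hl : ∀ b, (l b).1 ≠ (l b).2) (b : B) {x t : Λ} (hj : Joins l b x t) :
    far l b x = t := by
  unfold far
  rcases hj with ⟨h1, h2⟩ | ⟨h1, h2⟩
  · rw [if_pos h1, h2]
  · have hne : (l b).1 ≠ x := fun h => hl b (h.trans h2.symm)
    rw [if_neg hne, h1]

omit [Fintype Λ] [Fintype B] [DecidableEq B] in
/-- The endpoints of a link at `x` are `x` and the far endpoint, as a set condition. [cite: FrommForcrand2008, (6)] -/
theorem endpoints_zero_iff_far (l : B → Λ × Λ) (b : B) {x : Λ} (hb : (l b).1 = x ∨ (l b).2 = x) (D : Λ → ℕ) :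
    (D (l b).1 = 0 ∧ D (l b).2 = 0) ↔ (D x = 0 ∧ D (far l b x) = 0) := by
  unfold far
  rcases hb with h | h
  · rw [if_pos h, h]
  · by_cases h1 : (l b).1 = x
    · rw [if_pos h1, h1]
    · rw [if_neg h1, h, and_comm]

omit [DecidableEq B] in
/-- **THE `2`-CYCLE PART OF THE BARYON DETERMINANT AT `x` IS THE SUM OVER THE LINKS AT `x` WITH UNTOUCHED
FAR ENDPOINT** of `4^{-N} det K̃_{S(D + N e_b)}` (simple link set, `Γ = ±1`, `N` odd). [cite: FrommForcrand2008, (5)–(6)] -/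
theorem sum_twoCycle_eq (hN : Odd N) (l : B → Λ × Λ) (hl : ∀ b, (l b).1 ≠ (l b).2)
    (hsimp : ∀ b b', Joins l b' (l b).1 (l b).2 → b' = b) (Γ : B → ℂ) (hΓ : ∀ b, Γ b = 1 ∨ Γ b = -1)
    {D : Λ → ℕ} {x : Λ} (hx : D x = 0) :
    ∑ z ∈ Finset.univ.filter (fun z : Equiv.Perm (Free D) =>
        (z.cycleOf ⟨x, hx⟩ = z ∧ z ⟨x, hx⟩ ≠ ⟨x, hx⟩) ∧ z.support.card = 2), cycTerm N l Γ D z =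
      ((4 : ℂ)⁻¹) ^ N * ∑ b ∈ Finset.univ.filter (fun b => (l b).1 = x ∨ (l b).2 = x),
        (if D (l b).1 = 0 ∧ D (l b).2 = 0 then (Kred N l Γ (fun y => D y + N * bondObs l b y)).det else 0) := by
  set v : Free D := ⟨x, hx⟩ with hv
  rw [sum_twoCycle_eq_sum_swap l Γ v, ← Finset.sum_filter, Finset.filter_filter, Finset.mul_sum]
  -- drop the non-adjacent `u` on the left
  rw [← Finset.sum_filter_add_sum_filter_not (Finset.univ.filter (fun u : Free D => u ≠ v)) (fun u => Adj l x u.1),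
    Finset.sum_eq_zero (s := (Finset.univ.filter (fun u : Free D => u ≠ v)).filter (fun u => ¬Adj l x u.1))
      (fun u hu => by
        obtain ⟨hu1, hu2⟩ := Finset.mem_filter.1 hu
        exact cycTerm_swap_eq_zero_of_not_adj l Γ (Finset.mem_filter.1 hu1).2.symm hu2),
    add_zero, Finset.filter_filter]
  -- the bijection `b ↦ far endpoint`
  symm
  refine Finset.sum_bij (fun b hb => (⟨far l b x, ((endpoints_zero_iff_far l b (Finset.mem_filter.1 hb).2.1 D).1
      (Finset.mem_filter.1 hb).2.2).2⟩ : Free D)) (fun b hb => ?_) (fun b hb b' hb' hbb' => ?_) (fun u hu => ?_)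
    (fun b hb => ?_)
  · obtain ⟨-, hb1, hb2⟩ := Finset.mem_filter.1 hb
    have hj := joins_far l b hb1
    refine Finset.mem_filter.2 ⟨Finset.mem_univ _, fun h => ?_, ⟨b, hj⟩⟩
    exact (Adj.ne hl ⟨b, hj⟩) (congrArg Subtype.val h).symm
  · obtain ⟨-, hb1, -⟩ := Finset.mem_filter.1 hb
    obtain ⟨-, hb1', -⟩ := Finset.mem_filter.1 hb'
    have h1 := joins_far l b hb1
    have h2 := joins_far l b' hb1'
    have hfar : far l b' x = far l b x := (congrArg Subtype.val hbb').symm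
    rw [hfar] at h2
    -- both `b` and `b'` join `x` and `far l b x`
    have hb'' : Joins l b' (l b).1 (l b).2 := by
      rcases h1 with ⟨h11, h12⟩ | ⟨h11, h12⟩
      · rw [h11, h12]; exact h2
      · rw [h11, h12]; exact joins_comm.1 h2
    exact (hsimp b b' hb'').symm
  · obtain ⟨-, huv, ⟨b, hb⟩⟩ := Finset.mem_filter.1 hu
    have hb1 : (l b).1 = x ∨ (l b).2 = x := by
      rcases hb with ⟨h1, -⟩ | ⟨-, h2⟩
      · exact Or.inl h1
      · exact Or.inr h2
    have hfar : far l b x = u.1 := far_eq_of_joins l hl b hb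
    refine ⟨b, Finset.mem_filter.2 ⟨Finset.mem_univ _, hb1, ?_⟩, Subtype.ext hfar⟩
    exact (endpoints_zero_iff_far l b hb1 D).2 ⟨hx, hfar ▸ u.2⟩
  · obtain ⟨-, hb1, hb2⟩ := Finset.mem_filter.1 hb
    have hj := joins_far l b hb1
    have hfar0 : D (far l b x) = 0 := ((endpoints_zero_iff_far l b hb1 D).1 hb2).2
    have hne : v ≠ (⟨far l b x, hfar0⟩ : Free D) := fun h => (Adj.ne hl ⟨b, hj⟩) (congrArg Subtype.val h)
    rw [cycTerm_swap_eq hN l Γ hne b hj (hsimp b) (hΓ b)]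

end TwoCycles

/-! ### Stage B14: patterned loops — closing a baryon loop of length `≥ 4` with alternating
`1`/`N-1` partial dimers -/

section PatternedLoops

variable {Λ : Type*} [LinearOrder Λ] [Fintype Λ] {N : ℕ}
variable {B : Type*} [Fintype B] [DecidableEq B]

omit [LinearOrder Λ] [Fintype Λ] [Fintype B] [DecidableEq B] in
/-- In a simple link set a link is determined by the pair of sites it joins. [cite: FrommForcrand2008, (6)] -/
theorem eq_of_joins {l : B → Λ × Λ} (hsimp : ∀ b b', Joins l b' (l b).1 (l b).2 → b' = b) {b b' : B} {u v : Λ}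
    (hb : Joins l b u v) (hb' : Joins l b' u v) : b' = b := by
  refine hsimp b b' ?_
  rcases hb with ⟨h1, h2⟩ | ⟨h1, h2⟩
  · rw [h1, h2]; exact hb'
  · rw [h1, h2]; exact joins_comm.1 hb'

/-! #### Colour balance of a closed walk in a bipartite link set -/

omit [LinearOrder Λ] [Fintype B] [DecidableEq B] in
/-- **On the support of a permutation moving every point to a neighbour, the two colour classes of a
bipartite link set have the same size** (the permutation maps one class onto the other). [cite: SalmhoferSeiler1991, §2 (2.4)] -/
theorem card_filter_color_support [DecidableEq Λ] {l : B → Λ × Λ} {ε : Λ → Bool} (hε : ∀ b, ε (l b).1 ≠ ε (l b).2)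
    (π : Equiv.Perm Λ) (hπ : ∀ y ∈ π.support, Adj l y (π y)) :
    (π.support.filter (fun y => ε y = true)).card = (π.support.filter (fun y => ¬ε y = true)).card := by
  refine Finset.card_bij' (fun y _ => π y) (fun y _ => π.symm y) (fun y hy => ?_) (fun y hy => ?_)
    (fun y _ => π.symm_apply_apply y) (fun y _ => π.apply_symm_apply y)
  · obtain ⟨hy, hc⟩ := Finset.mem_filter.1 hy
    refine Finset.mem_filter.2 ⟨Equiv.Perm.apply_mem_support.2 hy, fun h => ?_⟩
    exact (Adj.color_ne hε (hπ y hy)) (hc.trans h.symm)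
  · obtain ⟨hy, hc⟩ := Finset.mem_filter.1 hy
    have hy' : π.symm y ∈ π.support := by
      rw [← Equiv.Perm.apply_mem_support, Equiv.apply_symm_apply]; exact hy
    refine Finset.mem_filter.2 ⟨hy', ?_⟩
    have hne := Adj.color_ne hε (hπ _ hy')
    rw [Equiv.apply_symm_apply] at hne
    have hyf : ε y = false := by simpa using hc
    rw [hyf] at hne
    simpa using hne

omit [LinearOrder Λ] [Fintype B] [DecidableEq B] in
/-- Hence such a support has even size `2k`, `k` the size of either colour class: closed walks in a
bipartite graph have even length. [cite: SalmhoferSeiler1991, §2 (2.4)] -/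
theorem card_support_eq_two_mul [DecidableEq Λ] {l : B → Λ × Λ} {ε : Λ → Bool} (hε : ∀ b, ε (l b).1 ≠ ε (l b).2)
    (π : Equiv.Perm Λ) (hπ : ∀ y ∈ π.support, Adj l y (π y)) :
    π.support.card = 2 * (π.support.filter (fun y => ε y = true)).card := by
  rw [← Finset.card_filter_add_card_filter_not (s := π.support) (fun y => ε y = true), ← card_filter_color_support hε π hπ]
  ring

/-! #### The patterned configuration -/

/-- The pattern value at a site: `1` partial dimer on the outgoing loop link at a site of colour `true`,
`N - 1` at a site of colour `false` (`N ≥ 2`). [cite: FrommForcrand2008, (6)] -/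
def patVal (h1 : 1 < N) (ε : Λ → Bool) (u : Λ) : Fin N := if ε u = true then ⟨1, h1⟩ else ⟨N - 1, by omega⟩

/-- **The patterned configuration** obtained from `n` by putting, on every link `{y, π y}` of the closed
walk `π`, `patVal` of its tail `y` (so that consecutive links carry `1, N-1, 1, N-1, …`) and keeping `n`
elsewhere. [cite: FrommForcrand2008, (6)] -/
def patCfg (h1 : 1 < N) (l : B → Λ × Λ) (ε : Λ → Bool) (n : B → Fin N) (π : Equiv.Perm Λ) : B → Fin N := fun b =>
  if π (l b).1 = (l b).2 then patVal h1 ε (l b).1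
  else if π (l b).2 = (l b).1 then patVal h1 ε (l b).2
  else n b

omit [LinearOrder Λ] [Fintype Λ] [Fintype B] [DecidableEq B] in
/-- The two pattern values at sites of different colours add up to `N`. [cite: FrommForcrand2008, (6)] -/
theorem patVal_add_patVal (h1 : 1 < N) (ε : Λ → Bool) {u v : Λ} (h : ε u ≠ ε v) :
    (patVal h1 ε u : ℕ) + (patVal h1 ε v : ℕ) = N := by
  unfold patVal
  rcases Bool.eq_false_or_eq_true (ε u) with hu | hu <;> rcases Bool.eq_false_or_eq_true (ε v) with hv | hv
  · exact absurd (hu.trans hv.symm) h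
  · simp only [hu, hv, if_true, Bool.false_eq_true, if_false]; omega
  · simp only [hu, hv, if_true, Bool.false_eq_true, if_false]; omega
  · exact absurd (hu.trans hv.symm) h

omit [LinearOrder Λ] [Fintype Λ] [Fintype B] [DecidableEq B] in
/-- The pattern value is `1` or `N - 1`. [cite: FrommForcrand2008, (6)] -/
theorem patVal_eq_or (h1 : 1 < N) (ε : Λ → Bool) (u : Λ) :
    (patVal h1 ε u : ℕ) = 1 ∨ (patVal h1 ε u : ℕ) = N - 1 := by
  unfold patVal
  split_ifs
  · exact Or.inl rfl
  · exact Or.inr rfl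

omit [LinearOrder Λ] [Fintype Λ] [Fintype B] [DecidableEq B] in
/-- Pattern values at sites of different colours differ (`N ≥ 3`). [cite: FrommForcrand2008, (6)] -/
theorem patVal_ne_patVal (h1 : 1 < N) (h3 : 3 ≤ N) (ε : Λ → Bool) {u v : Λ} (h : ε u ≠ ε v) :
    patVal h1 ε u ≠ patVal h1 ε v := by
  intro heq
  have hsum := patVal_add_patVal h1 ε h
  rw [heq] at hsum
  rcases patVal_eq_or h1 ε v with hv | hv <;> omega

omit [LinearOrder Λ] [Fintype Λ] [Fintype B] [DecidableEq B] in
/-- Pattern values are nonzero (`N ≥ 3`). [cite: FrommForcrand2008, (6)] -/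
theorem patVal_ne_zero (h1 : 1 < N) (h3 : 3 ≤ N) (ε : Λ → Bool) (u : Λ) : (patVal h1 ε u : ℕ) ≠ 0 := by
  rcases patVal_eq_or h1 ε u with hu | hu <;> omega

/-- The hypotheses on the closed walk `π` used below: its sites are untouched by the dimers of `n`, each
site hops to a neighbour, and no site returns after two steps (length `≥ 3`). [cite: FrommForcrand2008, (6)] -/
structure IsLoopOf (l : B → Λ × Λ) (n : B → Fin N) (π : Equiv.Perm Λ) : Prop where
  untouched : ∀ y ∈ π.support, siteDeg l n y = 0
  adj : ∀ y ∈ π.support, Adj l y (π y)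
  noReturn : ∀ y ∈ π.support, π (π y) ≠ y

omit [Fintype Λ] [DecidableEq B] in
/-- A link is untouched by `n` if one of its endpoints is. [cite: FrommForcrand2008, (6)] -/
theorem apply_eq_zero_of_siteDeg_fst (l : B → Λ × Λ) (n : B → Fin N) (b : B) (h : siteDeg l n (l b).1 = 0) :
    (n b : ℕ) = 0 := Nat.eq_zero_of_le_zero (h ▸ le_siteDeg_fst l n b)

omit [Fintype Λ] [DecidableEq B] in
/-- A link is untouched by `n` if one of its endpoints is. [cite: FrommForcrand2008, (6)] -/
theorem apply_eq_zero_of_siteDeg_snd (l : B → Λ × Λ) (n : B → Fin N) (b : B) (h : siteDeg l n (l b).2 = 0) :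
    (n b : ℕ) = 0 := Nat.eq_zero_of_le_zero (h ▸ le_siteDeg_snd l n b)

section Eval

variable {h1 : 1 < N} {l : B → Λ × Λ} {ε : Λ → Bool} {n : B → Fin N} {π : Equiv.Perm Λ}

omit [Fintype Λ] [Fintype B] [DecidableEq B] in
/-- Off the loop links the patterned configuration is `n`. [cite: FrommForcrand2008, (6)] -/
theorem patCfg_of_ne (b : B) (ha : π (l b).1 ≠ (l b).2) (hb : π (l b).2 ≠ (l b).1) :
    patCfg h1 l ε n π b = n b := by
  unfold patCfg; rw [if_neg ha, if_neg hb]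

omit [DecidableEq B] in
/-- On a loop link `y → π y = t` the value is `patVal y` (either orientation of the link). [cite: FrommForcrand2008, (6)] -/
theorem patCfg_of_joins_apply (hl : ∀ b, (l b).1 ≠ (l b).2) (hπ : IsLoopOf l n π) (b : B) {y t : Λ}
    (hj : Joins l b y t) (ht : π y = t) : patCfg h1 l ε n π b = patVal h1 ε y := by
  unfold patCfg
  rcases hj with ⟨hy, hty⟩ | ⟨hty, hy⟩
  · rw [if_pos (by rw [hy, hty]; exact ht), hy]
  · have hys : y ∈ π.support := Equiv.Perm.mem_support.2 (by rw [ht, ← hty, ← hy]; exact hl b)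
    have hno : ¬π (l b).1 = (l b).2 := by
      rw [hty, hy]; intro h; exact hπ.noReturn y hys (by rw [ht, h])
    rw [if_neg hno, if_pos (by rw [hy, hty]; exact ht), hy]

omit [DecidableEq B] in
/-- On a loop link `t → π t = y` the value is `patVal t`. [cite: FrommForcrand2008, (6)] -/
theorem patCfg_of_joins_apply_eq (hl : ∀ b, (l b).1 ≠ (l b).2) (hπ : IsLoopOf l n π) (b : B) {y t : Λ}
    (hj : Joins l b y t) (ht : π t = y) : patCfg h1 l ε n π b = patVal h1 ε t :=
  patCfg_of_joins_apply hl hπ b (joins_comm.1 hj) ht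

omit [Fintype Λ] [Fintype B] [DecidableEq B] in
/-- On a link at `y` that is not a loop link through `y` the value is `n b`. [cite: FrommForcrand2008, (6)] -/
theorem patCfg_of_joins_of_ne (b : B) {y t : Λ} (hj : Joins l b y t) (h1' : π y ≠ t) (h2' : π t ≠ y) :
    patCfg h1 l ε n π b = n b := by
  rcases hj with ⟨hy, hty⟩ | ⟨hty, hy⟩
  · exact patCfg_of_ne b (by rw [hy, hty]; exact h1') (by rw [hy, hty]; exact h2')
  · exact patCfg_of_ne b (by rw [hy, hty]; exact h2') (by rw [hy, hty]; exact h1')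

end Eval

/-! #### The site degrees of the patterned configuration -/

/-- **The patterned configuration saturates exactly the loop sites**:
`d_{n'}(y) = d_n(y) + N·[y ∈ supp π]` (simple bipartite link set, `N ≥ 2`). [cite: FrommForcrand2008, (6)] -/
theorem siteDeg_patCfg (h1 : 1 < N) (l : B → Λ × Λ) (hl : ∀ b, (l b).1 ≠ (l b).2)
    (hsimp : ∀ b b', Joins l b' (l b).1 (l b).2 → b' = b) (ε : Λ → Bool) (hε : ∀ b, ε (l b).1 ≠ ε (l b).2)
    (n : B → Fin N) (π : Equiv.Perm Λ) (hπ : IsLoopOf l n π) (y : Λ) :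
    siteDeg l (patCfg h1 l ε n π) y = siteDeg l n y + (if y ∈ π.support then N else 0) := by
  rw [siteDeg_eq_sum_filter l hl, siteDeg_eq_sum_filter l hl]
  set S := Finset.univ.filter (fun b => (l b).1 = y ∨ (l b).2 = y) with hS
  by_cases hy : y ∈ π.support
  · rw [if_pos hy]
    -- all links at `y` are untouched by `n`
    have hn0 : ∀ b ∈ S, (n b : ℕ) = 0 := fun b hb => by
      rcases (Finset.mem_filter.1 hb).2 with h | h
      · exact apply_eq_zero_of_siteDeg_fst l n b (h ▸ hπ.untouched y hy)
      · exact apply_eq_zero_of_siteDeg_snd l n b (h ▸ hπ.untouched y hy)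
    rw [Finset.sum_eq_zero hn0, zero_add]
    -- the two loop links at `y`
    obtain ⟨bp, hbp⟩ := hπ.adj y hy
    have hy' : π.symm y ∈ π.support := by
      rw [← Equiv.Perm.apply_mem_support, Equiv.apply_symm_apply]; exact hy
    obtain ⟨bm, hbm⟩ := hπ.adj (π.symm y) hy'
    rw [Equiv.apply_symm_apply] at hbm
    have hbpS : bp ∈ S := by
      refine Finset.mem_filter.2 ⟨Finset.mem_univ _, ?_⟩
      rcases hbp with ⟨h, -⟩ | ⟨-, h⟩
      · exact Or.inl h
      · exact Or.inr h
    have hbmS : bm ∈ S := by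
      refine Finset.mem_filter.2 ⟨Finset.mem_univ _, ?_⟩
      rcases hbm with ⟨-, h⟩ | ⟨h, -⟩
      · exact Or.inr h
      · exact Or.inl h
    have hne : bp ≠ bm := by
      intro heq
      rw [heq] at hbp
      -- `bm` joins `y`–`π y` and `π⁻¹ y`–`y`
      have hret : π (π y) = y ∨ π y = y := by
        rcases hbp with ⟨a1, a2⟩ | ⟨a1, a2⟩ <;> rcases hbm with ⟨c1, c2⟩ | ⟨c1, c2⟩
        · exact Or.inr (a2.symm.trans c2)
        · left; rw [a2.symm.trans c2, Equiv.apply_symm_apply]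
        · left; rw [a1.symm.trans c1, Equiv.apply_symm_apply]
        · exact Or.inr (a1.symm.trans c1)
      rcases hret with h | h
      · exact hπ.noReturn y hy h
      · exact (Equiv.Perm.mem_support.1 hy) h
    rw [Finset.sum_eq_add_of_mem bp bm hbpS hbmS hne (fun c hc hcne => ?_)]
    · rw [patCfg_of_joins_apply hl hπ bp hbp rfl, patCfg_of_joins_apply hl hπ bm hbm (Equiv.apply_symm_apply π y)]
      have hcol : ε y ≠ ε (π.symm y) := fun h => (Adj.color_ne hε ⟨bm, hbm⟩) h.symm
      exact patVal_add_patVal h1 ε hcol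
    · -- any other link at `y` is not a loop link
      have hj := joins_far l c (Finset.mem_filter.1 hc).2
      rw [patCfg_of_joins_of_ne c hj (fun h => hcne.1 ?_) (fun h => hcne.2 ?_), hn0 c hc]
      · exact eq_of_joins hsimp hbp (h ▸ hj)
      · have hfar : far l c y = π.symm y := (Equiv.eq_symm_apply π).2 h
        rw [hfar] at hj
        exact eq_of_joins hsimp hbm (joins_comm.1 hj)
  · rw [if_neg hy, add_zero]
    refine Finset.sum_congr rfl fun c hc => ?_
    have hj := joins_far l c (Finset.mem_filter.1 hc).2
    have hyfix : π y = y := by simpa [Equiv.Perm.mem_support] using hy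
    rw [patCfg_of_joins_of_ne c hj ?_ ?_]
    · rw [hyfix]; exact Adj.ne hl ⟨c, hj⟩
    · intro h
      by_cases hfs : far l c y ∈ π.support
      · exact hy (h ▸ Equiv.Perm.apply_mem_support.2 hfs)
      · have : π (far l c y) = far l c y := by simpa [Equiv.Perm.mem_support] using hfs
        exact (Adj.ne hl ⟨c, hj⟩) (this.symm.trans h).symm

/-- As a degree pattern. [cite: FrommForcrand2008, (6)] -/
theorem siteDeg_patCfg_eq (h1 : 1 < N) (l : B → Λ × Λ) (hl : ∀ b, (l b).1 ≠ (l b).2)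
    (hsimp : ∀ b b', Joins l b' (l b).1 (l b).2 → b' = b) (ε : Λ → Bool) (hε : ∀ b, ε (l b).1 ≠ ε (l b).2)
    (n : B → Fin N) (π : Equiv.Perm Λ) (hπ : IsLoopOf l n π) :
    siteDeg l (patCfg h1 l ε n π) = fun y => siteDeg l n y + (if y ∈ π.support then N else 0) :=
  funext (siteDeg_patCfg h1 l hl hsimp ε hε n π hπ)

/-- **The patterned configuration is admissible** when `n` is, and saturates every loop site. [cite: FrommForcrand2008, (6)] -/
theorem patCfg_adm (h1 : 1 < N) (l : B → Λ × Λ) (hl : ∀ b, (l b).1 ≠ (l b).2)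
    (hsimp : ∀ b b', Joins l b' (l b).1 (l b).2 → b' = b) (ε : Λ → Bool) (hε : ∀ b, ε (l b).1 ≠ ε (l b).2)
    (n : B → Fin N) (hadm : ∀ y, siteDeg l n y = 0 ∨ siteDeg l n y = N) (π : Equiv.Perm Λ) (hπ : IsLoopOf l n π)
    (y : Λ) : siteDeg l (patCfg h1 l ε n π) y = 0 ∨ siteDeg l (patCfg h1 l ε n π) y = N := by
  rw [siteDeg_patCfg h1 l hl hsimp ε hε n π hπ y]
  by_cases hy : y ∈ π.support
  · right; rw [if_pos hy, hπ.untouched y hy, zero_add]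
  · rw [if_neg hy, add_zero]; exact hadm y

/-- The loop sites are saturated in the patterned configuration. [cite: FrommForcrand2008, (6)] -/
theorem siteDeg_patCfg_of_mem (h1 : 1 < N) (l : B → Λ × Λ) (hl : ∀ b, (l b).1 ≠ (l b).2)
    (hsimp : ∀ b b', Joins l b' (l b).1 (l b).2 → b' = b) (ε : Λ → Bool) (hε : ∀ b, ε (l b).1 ≠ ε (l b).2)
    (n : B → Fin N) (π : Equiv.Perm Λ) (hπ : IsLoopOf l n π) {y : Λ} (hy : y ∈ π.support) :
    siteDeg l (patCfg h1 l ε n π) y = N := by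
  rw [siteDeg_patCfg h1 l hl hsimp ε hε n π hπ y, if_pos hy, hπ.untouched y hy, zero_add]

/-! #### The weight of the patterned configuration -/

/-- The tail of a loop link: the endpoint `y` with `π y =` the other endpoint. [cite: FrommForcrand2008, (6)] -/
def tail (l : B → Λ × Λ) (π : Equiv.Perm Λ) (b : B) : Λ := if π (l b).1 = (l b).2 then (l b).1 else (l b).2

omit [DecidableEq B] in
/-- **`w(n') = w(n) · ∏_{y ∈ supp π} c_{patVal y}`**: the loop links of `n'` carry the pattern values of
their tails, the other links carry `n` (and `n` vanishes on the loop links). [cite: FrommForcrand2008, (5)–(6)] -/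
theorem prod_dimerCoeff_patCfg_eq (h1 : 1 < N) (l : B → Λ × Λ) (hl : ∀ b, (l b).1 ≠ (l b).2)
    (hsimp : ∀ b b', Joins l b' (l b).1 (l b).2 → b' = b) (ε : Λ → Bool)
    (n : B → Fin N) (π : Equiv.Perm Λ) (hπ : IsLoopOf l n π) :
    ∏ b, dimerCoeff N (patCfg h1 l ε n π b : ℕ) =
      (∏ b, dimerCoeff N (n b : ℕ)) * ∏ y ∈ π.support, dimerCoeff N (patVal h1 ε y : ℕ) := by
  set C := Finset.univ.filter (fun b : B => π (l b).1 = (l b).2 ∨ π (l b).2 = (l b).1) with hC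
  -- loop links carry no dimer of `n`
  have hn0 : ∀ b ∈ C, (n b : ℕ) = 0 := fun b hb => by
    rcases (Finset.mem_filter.1 hb).2 with h | h
    · exact apply_eq_zero_of_siteDeg_fst l n b
        (hπ.untouched _ (Equiv.Perm.mem_support.2 (by rw [h]; exact (hl b).symm)))
    · exact apply_eq_zero_of_siteDeg_snd l n b
        (hπ.untouched _ (Equiv.Perm.mem_support.2 (by rw [h]; exact hl b)))
  rw [← Finset.prod_filter_mul_prod_filter_not Finset.univ (fun b : B => π (l b).1 = (l b).2 ∨ π (l b).2 = (l b).1),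
    ← Finset.prod_filter_mul_prod_filter_not Finset.univ (fun b : B => π (l b).1 = (l b).2 ∨ π (l b).2 = (l b).1)
      (fun b => dimerCoeff N (n b : ℕ))]
  have hA : ∏ b ∈ C, dimerCoeff N (n b : ℕ) = 1 :=
    Finset.prod_eq_one fun b hb => by rw [hn0 b hb, dimerCoeff_zero]
  have hB : ∏ b ∈ Finset.univ.filter (fun b : B => ¬(π (l b).1 = (l b).2 ∨ π (l b).2 = (l b).1)),
      dimerCoeff N (patCfg h1 l ε n π b : ℕ) =
      ∏ b ∈ Finset.univ.filter (fun b : B => ¬(π (l b).1 = (l b).2 ∨ π (l b).2 = (l b).1)), dimerCoeff N (n b : ℕ) :=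
    Finset.prod_congr rfl fun b hb => by
      have h := (Finset.mem_filter.1 hb).2
      rw [patCfg_of_ne b (fun h' => h (Or.inl h')) (fun h' => h (Or.inr h'))]
  rw [← hC, hA, one_mul, hB, mul_comm]
  congr 1
  -- the bijection loop links ≃ loop sites, `b ↦ tail b`
  refine Finset.prod_bij (fun b _ => tail l π b) (fun b hb => ?_) (fun b hb b' hb' hbb => ?_) (fun y hy => ?_)
    (fun b hb => ?_)
  · unfold tail
    rcases (Finset.mem_filter.1 hb).2 with h | h
    · rw [if_pos h]; exact Equiv.Perm.mem_support.2 (by rw [h]; exact (hl b).symm)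
    · have hno : ¬π (l b).1 = (l b).2 := fun h' =>
        hπ.noReturn _ (Equiv.Perm.mem_support.2 (by rw [h]; exact hl b)) (by rw [h, h'])
      rw [if_neg hno]; exact Equiv.Perm.mem_support.2 (by rw [h]; exact hl b)
  · -- `b` and `b'` both join `tail` and `π tail`
    have key : ∀ c ∈ C, Joins l c (tail l π c) (π (tail l π c)) := fun c hc => by
      unfold tail
      rcases (Finset.mem_filter.1 hc).2 with h | h
      · rw [if_pos h, h]; exact Or.inl ⟨rfl, rfl⟩
      · have hno : ¬π (l c).1 = (l c).2 := fun h' =>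
          hπ.noReturn _ (Equiv.Perm.mem_support.2 (by rw [h]; exact hl c)) (by rw [h, h'])
        rw [if_neg hno, h]; exact Or.inr ⟨rfl, rfl⟩
    have h2 := key b' hb'
    rw [← hbb] at h2
    exact (eq_of_joins hsimp (key b hb) h2).symm
  · obtain ⟨b, hb⟩ := hπ.adj y hy
    have hys : π y ≠ y := Equiv.Perm.mem_support.1 hy
    refine ⟨b, Finset.mem_filter.2 ⟨Finset.mem_univ _, ?_⟩, ?_⟩
    · rcases hb with ⟨h1', h2'⟩ | ⟨h1', h2'⟩
      · exact Or.inl (by rw [h1', h2'])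
      · exact Or.inr (by rw [h1', h2'])
    · unfold tail
      rcases hb with ⟨h1', h2'⟩ | ⟨h1', h2'⟩
      · rw [if_pos (by rw [h1', h2']), h1']
      · have hno : ¬π (l b).1 = (l b).2 := by rw [h1', h2']; exact hπ.noReturn y hy
        rw [if_neg hno, h2']
  · -- the value on a loop link is the pattern value of its tail
    unfold tail
    rcases (Finset.mem_filter.1 hb).2 with h | h
    · rw [if_pos h, patCfg_of_joins_apply hl hπ b (joins_self l b) h]
    · have hno : ¬π (l b).1 = (l b).2 := fun h' =>
        hπ.noReturn _ (Equiv.Perm.mem_support.2 (by rw [h]; exact hl b)) (by rw [h, h'])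
      rw [if_neg hno, patCfg_of_joins_apply hl hπ b (joins_comm.1 (joins_self l b)) h]

omit [DecidableEq B] in
/-- **`w(n') = w(n) · (c_1 c_{N-1})^k`**, `2k` the length of the loop (`k` sites of each colour). [cite: FrommForcrand2008, (5)–(6)] -/
theorem prod_dimerCoeff_patCfg (h1 : 1 < N) (l : B → Λ × Λ) (hl : ∀ b, (l b).1 ≠ (l b).2)
    (hsimp : ∀ b b', Joins l b' (l b).1 (l b).2 → b' = b) (ε : Λ → Bool) (hε : ∀ b, ε (l b).1 ≠ ε (l b).2)
    (n : B → Fin N) (π : Equiv.Perm Λ) (hπ : IsLoopOf l n π) :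
    ∏ b, dimerCoeff N (patCfg h1 l ε n π b : ℕ) =
      (∏ b, dimerCoeff N (n b : ℕ)) *
        (dimerCoeff N 1 * dimerCoeff N (N - 1)) ^ (π.support.filter (fun y => ε y = true)).card := by
  rw [prod_dimerCoeff_patCfg_eq h1 l hl hsimp ε n π hπ,
    ← Finset.prod_filter_mul_prod_filter_not π.support (fun y => ε y = true), mul_pow,
    Finset.prod_congr rfl fun y hy => show dimerCoeff N (patVal h1 ε y : ℕ) = dimerCoeff N 1 by
      rw [patVal, if_pos (Finset.mem_filter.1 hy).2],
    Finset.prod_congr rfl fun y hy => show dimerCoeff N (patVal h1 ε y : ℕ) = dimerCoeff N (N - 1) by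
      rw [patVal, if_neg (Finset.mem_filter.1 hy).2],
    Finset.prod_const, Finset.prod_const, ← card_filter_color_support hε π hπ.adj]

/-- **`c_1 c_{N-1} (N!)² = 4^{-N}`** (`N ≥ 2`): the weight of a closed patterned loop of length `2k` is
`4^{-Nk}` times that of the bare loop — exactly the size of the baryon-loop term it replaces. [cite: FrommForcrand2008, (5)–(6)] -/
theorem dimerCoeff_one_mul_pred (h1 : 1 < N) :
    dimerCoeff N 1 * dimerCoeff N (N - 1) * (N.factorial : ℂ) ^ 2 = ((4 : ℂ)⁻¹) ^ N := by
  have h := dimerCoeff_pred_mul_factorial_sq (N := N) (by omega)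
  have hc1 : dimerCoeff N 1 * (4 * (N : ℂ)) = 1 := by
    obtain ⟨M, rfl⟩ : ∃ M, N = M + 1 := ⟨N - 1, by omega⟩
    rw [dimerCoeff, Nat.add_sub_cancel, Nat.factorial_succ, Nat.factorial_one, pow_one]
    have hf : ((M.factorial : ℂ)) ≠ 0 := Nat.cast_ne_zero.2 (Nat.factorial_ne_zero M)
    have hM : ((M : ℂ) + 1) ≠ 0 := by exact_mod_cast Nat.succ_ne_zero M
    push_cast
    field_simp
  calc dimerCoeff N 1 * dimerCoeff N (N - 1) * (N.factorial : ℂ) ^ 2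
      = dimerCoeff N 1 * (dimerCoeff N (N - 1) * (N.factorial : ℂ) ^ 2) := by ring
    _ = dimerCoeff N 1 * (4 * (N : ℂ)) * ((4 : ℂ)⁻¹) ^ N := by rw [h]; ring
    _ = ((4 : ℂ)⁻¹) ^ N := by rw [hc1, one_mul]

end PatternedLoops

/-! #### From a long baryon loop `z` through an untouched site to the closed walk `ofSubtype z` on `Λ` -/

section LoopOfCycle

variable {Λ : Type*} [LinearOrder Λ] [Fintype Λ] {N : ℕ}
variable {B : Type*} [Fintype B] [DecidableEq B]

omit [Fintype B] [DecidableEq B] in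
/-- Support of the extension by the identity of a permutation of the untouched sites. [cite: Biggs1974, Proposition 7.2] -/
theorem mem_support_ofSubtype_iff {D : Λ → ℕ} (z : Equiv.Perm (Free D)) (y : Λ) :
    y ∈ (Equiv.Perm.ofSubtype z).support ↔ ∃ h : D y = 0, (⟨y, h⟩ : Free D) ∈ z.support := by
  rw [Equiv.Perm.support_ofSubtype, Finset.mem_map]
  constructor
  · rintro ⟨u, hu, rfl⟩
    exact ⟨u.2, by simpa using hu⟩
  · rintro ⟨h, hu⟩
    exact ⟨⟨y, h⟩, hu, rfl⟩

omit [Fintype B] [DecidableEq B] in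
/-- The extended permutation has the same number of moved points. [cite: Biggs1974, Proposition 7.2] -/
theorem card_support_ofSubtype {D : Λ → ℕ} (z : Equiv.Perm (Free D)) :
    (Equiv.Perm.ofSubtype z).support.card = z.support.card := by
  rw [Equiv.Perm.support_ofSubtype, Finset.card_map]

omit [Fintype B] [DecidableEq B] in
/-- A cyclic permutation whose support does not have two elements never returns after two steps. [cite: Biggs1974, Proposition 7.2] -/
theorem apply_apply_ne_of_isCycle {α : Type*} [Fintype α] [DecidableEq α] {z : Equiv.Perm α} (hz : z.IsCycle)
    (hcard : z.support.card ≠ 2) {u : α} (hu : u ∈ z.support) : z (z u) ≠ u := by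
  intro h
  have h2 : z ^ 2 = 1 := (hz.pow_eq_one_iff (n := 2)).2 ⟨u, Equiv.Perm.mem_support.1 hu, by rw [pow_two, Equiv.Perm.mul_apply, h]⟩
  have hdvd : z.support.card ∣ 2 := by rw [← hz.orderOf]; exact orderOf_dvd_of_pow_eq_one h2
  have hle : z.support.card ≤ 2 := Nat.le_of_dvd (by norm_num) hdvd
  have hlt : 1 < z.support.card := Equiv.Perm.one_lt_card_support_of_ne_one hz.ne_one
  omega

omit [DecidableEq B] in
/-- **A long baryon loop through the untouched site `x` is a closed walk for the configuration `n`**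
(its sites are untouched, each hops to a neighbour, no return after two steps). [cite: FrommForcrand2008, (6)] -/
theorem isLoopOf_ofSubtype (l : B → Λ × Λ) (n : B → Fin N) {x : Λ} (hx : siteDeg l n x = 0)
    (z : Equiv.Perm (Free (siteDeg l n)))
    (hz : z.cycleOf ⟨x, hx⟩ = z ∧ z ⟨x, hx⟩ ≠ ⟨x, hx⟩) (hcard : z.support.card ≠ 2)
    (hgraph : ∀ u ∈ z.support, Adj l u.1 (z u).1) : IsLoopOf l n (Equiv.Perm.ofSubtype z) := by
  have hcyc : z.IsCycle := ((Literature.LinearAlgebra.Matrix.cycleOf_eq_self_and_ne_iff z _).1 hz).1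
  refine ⟨fun y hy => ?_, fun y hy => ?_, fun y hy => ?_⟩
  · exact ((mem_support_ofSubtype_iff z y).1 hy).1
  · obtain ⟨h, hu⟩ := (mem_support_ofSubtype_iff z y).1 hy
    rw [Equiv.Perm.ofSubtype_apply_of_mem z h]
    exact hgraph _ hu
  · obtain ⟨h, hu⟩ := (mem_support_ofSubtype_iff z y).1 hy
    rw [Equiv.Perm.ofSubtype_apply_of_mem z h, Equiv.Perm.ofSubtype_apply_coe]
    intro heq
    exact apply_apply_ne_of_isCycle hcyc hcard hu (Subtype.ext heq)

omit [Fintype B] [DecidableEq B] in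
/-- The base site lies on the walk. [cite: FrommForcrand2008, (6)] -/
theorem mem_support_ofSubtype_base {D : Λ → ℕ} {x : Λ} (hx : D x = 0) (z : Equiv.Perm (Free D))
    (hz : z.cycleOf ⟨x, hx⟩ = z ∧ z ⟨x, hx⟩ ≠ ⟨x, hx⟩) : x ∈ (Equiv.Perm.ofSubtype z).support :=
  (mem_support_ofSubtype_iff z x).2 ⟨hx, Equiv.Perm.mem_support.2 hz.2⟩

omit [Fintype B] [DecidableEq B] in
/-- Every site of the walk is an iterate of the base site. [cite: Biggs1974, Proposition 7.2] -/
theorem exists_pow_apply_base {D : Λ → ℕ} {x : Λ} (hx : D x = 0) (z : Equiv.Perm (Free D))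
    (hz : z.cycleOf ⟨x, hx⟩ = z ∧ z ⟨x, hx⟩ ≠ ⟨x, hx⟩) {y : Λ} (hy : y ∈ (Equiv.Perm.ofSubtype z).support) :
    ∃ i : ℕ, (Equiv.Perm.ofSubtype z ^ i) x = y := by
  have hcyc : z.IsCycle := ((Literature.LinearAlgebra.Matrix.cycleOf_eq_self_and_ne_iff z _).1 hz).1
  obtain ⟨h, hu⟩ := (mem_support_ofSubtype_iff z y).1 hy
  obtain ⟨i, hi⟩ := hcyc.exists_pow_eq hz.2 (Equiv.Perm.mem_support.1 hu)
  refine ⟨i, ?_⟩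
  rw [← map_pow]
  show (Equiv.Perm.ofSubtype (z ^ i)) ((⟨x, hx⟩ : Free D) : Λ) = y
  rw [Equiv.Perm.ofSubtype_apply_coe, hi]

omit [DecidableEq B] in
/-- The walk hypothesis `adj` restricted to the untouched sites. [cite: FrommForcrand2008, (6)] -/
theorem adj_of_isLoopOf {l : B → Λ × Λ} {n : B → Fin N} {z : Equiv.Perm (Free (siteDeg l n))}
    (hπ : IsLoopOf l n (Equiv.Perm.ofSubtype z)) (u : Free (siteDeg l n)) (hu : u ∈ z.support) : Adj l u.1 (z u).1 := by
  have hy : u.1 ∈ (Equiv.Perm.ofSubtype z).support := (mem_support_ofSubtype_iff z u.1).2 ⟨u.2, by simpa using hu⟩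
  have := hπ.adj u.1 hy
  rwa [Equiv.Perm.ofSubtype_apply_coe] at this

/-! #### The untouched sites of the patterned configuration -/

omit [Fintype B] [DecidableEq B] in
/-- The pattern `D + N·1_{supp}` vanishes exactly at the untouched sites off the walk (`N ≥ 1`). [cite: FrommForcrand2008, (6)] -/
theorem loopPattern_eq_zero_iff (hN : 0 < N) {D : Λ → ℕ} (z : Equiv.Perm (Free D)) (D' : Λ → ℕ)
    (hD' : ∀ y, D' y = D y + (if y ∈ (Equiv.Perm.ofSubtype z).support then N else 0)) (y : Λ) :
    D' y = 0 ↔ D y = 0 ∧ y ∉ (Equiv.Perm.ofSubtype z).support := by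
  rw [hD' y]
  constructor
  · intro h
    by_cases hy : y ∈ (Equiv.Perm.ofSubtype z).support
    · rw [if_pos hy] at h; omega
    · rw [if_neg hy] at h; exact ⟨by omega, hy⟩
  · rintro ⟨h0, hy⟩
    rw [h0, if_neg hy]

/-- The untouched sites of the patterned configuration, as the untouched sites of `n` off the loop. [cite: FrommForcrand2008, (6)] -/
def freeLoopEquiv (hN : 0 < N) {D : Λ → ℕ} (z : Equiv.Perm (Free D)) (D' : Λ → ℕ)
    (hD' : ∀ y, D' y = D y + (if y ∈ (Equiv.Perm.ofSubtype z).support then N else 0)) :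
    Free D' ≃ {u : Free D // u ∉ z.support} where
  toFun p := ⟨⟨p.1, ((loopPattern_eq_zero_iff hN z D' hD' p.1).1 p.2).1⟩, fun hu =>
    ((loopPattern_eq_zero_iff hN z D' hD' p.1).1 p.2).2 ((mem_support_ofSubtype_iff z p.1).2 ⟨_, hu⟩)⟩
  invFun w := ⟨w.1.1, (loopPattern_eq_zero_iff hN z D' hD' w.1.1).2 ⟨w.1.2, fun hy => by
    obtain ⟨h, hu⟩ := (mem_support_ofSubtype_iff z w.1.1).1 hy
    exact w.2 (by have : (⟨w.1.1, h⟩ : Free D) = w.1 := Subtype.ext rfl; rw [this] at hu; exact hu)⟩⟩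
  left_inv p := Subtype.ext rfl
  right_inv w := Subtype.ext (Subtype.ext rfl)

omit [DecidableEq B] in
/-- **The baryon determinant of the patterned configuration is the complementary minor of the loop.** [cite: FrommForcrand2008, (6)] -/
theorem det_submatrix_loop_eq (hN : 0 < N) (l : B → Λ × Λ) (Γ : B → ℂ) {D : Λ → ℕ} (z : Equiv.Perm (Free D)) (D' : Λ → ℕ)
    (hD' : ∀ y, D' y = D y + (if y ∈ (Equiv.Perm.ofSubtype z).support then N else 0)) :
    ((Kred N l Γ D).submatrix (Subtype.val : {u // u ∉ z.support} → Free D) Subtype.val).det = (Kred N l Γ D').det := by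
  rw [← Matrix.det_submatrix_equiv_self (freeLoopEquiv hN z D' hD')]
  congr 1

omit [Fintype B] [DecidableEq B] in
/-- The loop removes its sites from the untouched set: `|S'| + |supp z| = |S|`. [cite: FrommForcrand2008, (6)] -/
theorem card_free_loop (hN : 0 < N) {D : Λ → ℕ} (z : Equiv.Perm (Free D)) (D' : Λ → ℕ)
    (hD' : ∀ y, D' y = D y + (if y ∈ (Equiv.Perm.ofSubtype z).support then N else 0)) :
    Fintype.card (Free D') + z.support.card = Fintype.card (Free D) := by
  have hle : z.support.card ≤ Fintype.card (Free D) := Finset.card_le_univ _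
  rw [Fintype.card_congr (freeLoopEquiv hN z D' hD'), Fintype.card_subtype_compl, Fintype.card_coe]
  omega

/-- **THE WEIGHT OF THE PATTERNED CONFIGURATION**: `W(n') = w(n) (N!)^{-|S(n)|} 4^{-Nk} det K̃[S(n) ∖ supp z]`,
`2k = |supp z|` — the patterned loop costs exactly the modulus `4^{-Nk} = 2^{-N·2k}` of the baryon-loop
term it closes. [cite: FrommForcrand2008, (5)–(6)] -/
theorem zWeight_patCfg (h1 : 1 < N) (l : B → Λ × Λ) (hl : ∀ b, (l b).1 ≠ (l b).2)
    (hsimp : ∀ b b', Joins l b' (l b).1 (l b).2 → b' = b) (ε : Λ → Bool) (hε : ∀ b, ε (l b).1 ≠ ε (l b).2)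
    (Γ : B → ℂ) (n : B → Fin N) (z : Equiv.Perm (Free (siteDeg l n))) (hπ : IsLoopOf l n (Equiv.Perm.ofSubtype z)) :
    zWeight N l Γ (patCfg h1 l ε n (Equiv.Perm.ofSubtype z)) =
      (∏ b, dimerCoeff N (n b : ℕ)) * ((N.factorial : ℂ)⁻¹ ^ Fintype.card (Free (siteDeg l n)) *
        (((4 : ℂ)⁻¹) ^ (N * ((Equiv.Perm.ofSubtype z).support.filter (fun y => ε y = true)).card) *
          ((Kred N l Γ (siteDeg l n)).submatrix (Subtype.val : {u // u ∉ z.support} → Free (siteDeg l n)) Subtype.val).det)) := by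
  set k := ((Equiv.Perm.ofSubtype z).support.filter (fun y => ε y = true)).card with hk
  have hpat := siteDeg_patCfg_eq h1 l hl hsimp ε hε n _ hπ
  have hD' : ∀ y, (fun y => siteDeg l n y + (if y ∈ (Equiv.Perm.ofSubtype z).support then N else 0)) y =
      siteDeg l n y + (if y ∈ (Equiv.Perm.ofSubtype z).support then N else 0) := fun y => rfl
  have hcard := card_free_loop (by omega) z _ hD'
  rw [← card_support_ofSubtype z, card_support_eq_two_mul hε _ hπ.adj, ← hk] at hcard
  rw [zWeight, prod_dimerCoeff_patCfg h1 l hl hsimp ε hε n _ hπ, hpat, ← det_submatrix_loop_eq (by omega) l Γ z _ hD',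
    ← hcard, ← hk, pow_add, pow_mul, pow_mul]
  have hcc : dimerCoeff N 1 * dimerCoeff N (N - 1) = ((4 : ℂ)⁻¹) ^ N * ((N.factorial : ℂ)⁻¹) ^ 2 := by
    have h := dimerCoeff_one_mul_pred (N := N) h1
    have hF : ((N.factorial : ℂ)) ≠ 0 := Nat.cast_ne_zero.2 (Nat.factorial_ne_zero N)
    field_simp
    linear_combination h
  rw [hcc, mul_pow]
  ring

/-! #### The modulus of a baryon-loop term -/

omit [Fintype Λ] [DecidableEq B] in
/-- A hopping-matrix entry between adjacent untouched sites is real of modulus `2^{-N}` (simple link set,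
`Γ = ±1`). [cite: FrommForcrand2008, (5)] -/
theorem Kred_apply_real_of_adj (l : B → Λ × Λ) (hl : ∀ b, (l b).1 ≠ (l b).2)
    (hsimp : ∀ b b', Joins l b' (l b).1 (l b).2 → b' = b) (Γ : B → ℂ) (hΓ : ∀ b, Γ b = 1 ∨ Γ b = -1)
    {D : Λ → ℕ} (u w : Free D) (h : Adj l u.1 w.1) :
    ∃ s : ℝ, |s| = (1 / 2 : ℝ) ^ N ∧ Kred N l Γ D u w = (s : ℂ) := by
  obtain ⟨b, hb⟩ := h
  have huw : u.1 ≠ w.1 := Adj.ne hl ⟨b, hb⟩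
  have hsingle : Kred N l Γ D u w = (if (l b).1 = u.1 ∧ (l b).2 = w.1 then (-(Γ b / 2)) ^ N else 0) +
      (if (l b).1 = w.1 ∧ (l b).2 = u.1 then (Γ b / 2) ^ N else 0) := by
    rw [Kred]
    refine Finset.sum_eq_single b (fun b' _ hb' => ?_) (fun h => absurd (Finset.mem_univ b) h)
    have hnot : ¬Joins l b' u.1 w.1 := fun h => hb' (eq_of_joins hsimp hb h)
    rw [if_neg fun h => hnot (Or.inl h), if_neg fun h => hnot (Or.inr h), add_zero]
  obtain ⟨γ, hγ1, hγ⟩ : ∃ γ : ℝ, |γ| = 1 ∧ Γ b = (γ : ℂ) := by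
    rcases hΓ b with h | h
    · exact ⟨1, abs_one, by rw [h]; norm_num⟩
    · exact ⟨-1, by rw [abs_neg, abs_one], by rw [h]; norm_num⟩
  rw [hsingle, hγ]
  rcases hb with ⟨h1', h2'⟩ | ⟨h1', h2'⟩
  · have hno : ¬((l b).1 = w.1 ∧ (l b).2 = u.1) := fun h => huw (h1'.symm.trans h.1)
    refine ⟨(-(γ / 2)) ^ N, ?_, ?_⟩
    · rw [abs_pow, abs_neg, abs_div, hγ1, abs_two]
    · rw [if_pos ⟨h1', h2'⟩, if_neg hno, add_zero]; push_cast; ring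
  · have hno : ¬((l b).1 = u.1 ∧ (l b).2 = w.1) := fun h => huw (h.1.symm.trans h1')
    refine ⟨(γ / 2) ^ N, ?_, ?_⟩
    · rw [abs_pow, abs_div, hγ1, abs_two]
    · rw [if_neg hno, if_pos ⟨h1', h2'⟩, zero_add]; push_cast; ring

omit [DecidableEq B] in
/-- The hop product along (part of) a baryon loop is real of modulus `2^{-N·length}`. [cite: FrommForcrand2008, (5)–(6)] -/
theorem prod_Kred_real (l : B → Λ × Λ) (hl : ∀ b, (l b).1 ≠ (l b).2)
    (hsimp : ∀ b b', Joins l b' (l b).1 (l b).2 → b' = b) (Γ : B → ℂ) (hΓ : ∀ b, Γ b = 1 ∨ Γ b = -1)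
    {D : Λ → ℕ} (z : Equiv.Perm (Free D)) (hgraph : ∀ u ∈ z.support, Adj l u.1 (z u).1)
    (T : Finset (Free D)) (hT : T ⊆ z.support) :
    ∃ r : ℝ, |r| = (1 / 2 : ℝ) ^ (N * T.card) ∧ ∏ i ∈ T, Kred N l Γ D (z i) i = (r : ℂ) := by
  induction T using Finset.induction_on with
  | empty => exact ⟨1, by simp, by simp⟩
  | insert i T hi ih =>
    obtain ⟨r, hr, hprod⟩ := ih ((Finset.subset_insert i T).trans hT)
    obtain ⟨s, hs, hKi⟩ := Kred_apply_real_of_adj l hl hsimp Γ hΓ (z i) i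
      (adj_comm.1 (hgraph i (hT (Finset.mem_insert_self i T))))
    refine ⟨s * r, ?_, ?_⟩
    · rw [abs_mul, hs, hr, Finset.card_insert_of_notMem hi, ← pow_add]; congr 1; ring
    · rw [Finset.prod_insert hi, hprod, hKi]; push_cast; ring

omit [DecidableEq B] in
/-- **The signed hop product of a baryon loop is real of modulus `2^{-N·length}`.** [cite: FrommForcrand2008, (6)] -/
theorem sign_mul_prod_Kred_real (l : B → Λ × Λ) (hl : ∀ b, (l b).1 ≠ (l b).2)
    (hsimp : ∀ b b', Joins l b' (l b).1 (l b).2 → b' = b) (Γ : B → ℂ) (hΓ : ∀ b, Γ b = 1 ∨ Γ b = -1)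
    {D : Λ → ℕ} (z : Equiv.Perm (Free D)) (hgraph : ∀ u ∈ z.support, Adj l u.1 (z u).1) :
    ∃ r : ℝ, |r| = (1 / 2 : ℝ) ^ (N * z.support.card) ∧
      ((Equiv.Perm.sign z : ℤ) : ℂ) * ∏ i ∈ z.support, Kred N l Γ D (z i) i = (r : ℂ) := by
  obtain ⟨r, hr, hprod⟩ := prod_Kred_real l hl hsimp Γ hΓ z hgraph z.support (subset_refl _)
  rcases Int.units_eq_one_or (Equiv.Perm.sign z) with h | h
  · exact ⟨r, hr, by rw [h, hprod]; push_cast; ring⟩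
  · exact ⟨-r, by rw [abs_neg, hr], by rw [h, hprod]; push_cast; ring⟩

omit [DecidableEq B] in
/-- The baryon determinant of any pattern is a nonnegative real (`N` odd, `Γ = ±1`). [cite: Cayley1849, pp. 93–96] -/
theorem det_Kred_real_nonneg (hN : Odd N) (l : B → Λ × Λ) (Γ : B → ℂ) (hΓ : ∀ b, Γ b = 1 ∨ Γ b = -1) (D : Λ → ℕ) :
    ∃ d : ℝ, 0 ≤ d ∧ (Kred N l Γ D).det = (d : ℂ) := by
  have hΓ' : Γ = fun b => (((Γ b).re : ℝ) : ℂ) := funext fun b => by rcases hΓ b with h | h <;> simp [h]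
  rw [hΓ', det_Kred_ofReal]
  exact ⟨_, det_KredR_nonneg hN l _ D, rfl⟩

omit [LinearOrder Λ] [Fintype Λ] [DecidableEq B] in
/-- The dimer weight `w(n) = ∏_b c_{n_b}` is a nonnegative real. [cite: FrommForcrand2008, (5)] -/
theorem prod_dimerCoeff_real_nonneg (n : B → Fin N) : ∃ p : ℝ, 0 ≤ p ∧ ∏ b, dimerCoeff N (n b : ℕ) = (p : ℂ) := by
  refine ⟨∏ b, ((N - (n b : ℕ)).factorial : ℝ) / ((N.factorial : ℝ) * ((n b : ℕ).factorial : ℝ)) * (1 / 4 : ℝ) ^ (n b : ℕ),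
    Finset.prod_nonneg fun b _ => dimerCoeffR_nonneg _, ?_⟩
  rw [Complex.ofReal_prod]
  exact Finset.prod_congr rfl fun b _ => dimerCoeff_eq_ofReal _

open scoped ComplexOrder in
/-- **GAIN ≥ LOSS, TERM BY TERM**: for a long baryon loop `z` through the untouched site `x` of an
admissible configuration `n`, the loop term `w(n)(N!)^{-|S|}·cycTerm z` of the baryonic weight at `x`
is at most the weight `W(n')` of the patterned configuration closing the loop (`N` odd `≥ 3`, simple
bipartite link set, `Γ = ±1`). [cite: FrommForcrand2008, (5)–(6)] [cite: SalmhoferSeiler1991, Lemma 4.7 (4.38)] -/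
theorem weight_mul_cycTerm_le_zWeight_patCfg (hN : Odd N) (h3 : 3 ≤ N) (l : B → Λ × Λ) (hl : ∀ b, (l b).1 ≠ (l b).2)
    (hsimp : ∀ b b', Joins l b' (l b).1 (l b).2 → b' = b) (ε : Λ → Bool) (hε : ∀ b, ε (l b).1 ≠ ε (l b).2)
    (Γ : B → ℂ) (hΓ : ∀ b, Γ b = 1 ∨ Γ b = -1) (n : B → Fin N)
    (z : Equiv.Perm (Free (siteDeg l n))) (hπ : IsLoopOf l n (Equiv.Perm.ofSubtype z)) :
    (∏ b, dimerCoeff N (n b : ℕ)) * ((N.factorial : ℂ)⁻¹ ^ Fintype.card (Free (siteDeg l n)) * cycTerm N l Γ (siteDeg l n) z) ≤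
      zWeight N l Γ (patCfg (lt_of_lt_of_le (by norm_num) h3) l ε n (Equiv.Perm.ofSubtype z)) := by
  rw [zWeight_patCfg _ l hl hsimp ε hε Γ n z hπ, cycTerm]
  set k := ((Equiv.Perm.ofSubtype z).support.filter (fun y => ε y = true)).card with hk
  obtain ⟨p, hp, hpe⟩ := prod_dimerCoeff_real_nonneg (N := N) n
  have hD' : ∀ y, (fun y => siteDeg l n y + (if y ∈ (Equiv.Perm.ofSubtype z).support then N else 0)) y =
      siteDeg l n y + (if y ∈ (Equiv.Perm.ofSubtype z).support then N else 0) := fun y => rfl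
  obtain ⟨d, hd, hde⟩ := det_Kred_real_nonneg hN l Γ hΓ
    (fun y => siteDeg l n y + (if y ∈ (Equiv.Perm.ofSubtype z).support then N else 0))
  rw [← det_submatrix_loop_eq hN.pos l Γ z _ hD'] at hde
  obtain ⟨r, hr, hre⟩ := sign_mul_prod_Kred_real l hl hsimp Γ hΓ z (adj_of_isLoopOf hπ)
  rw [← card_support_ofSubtype z, card_support_eq_two_mul hε _ hπ.adj, ← hk] at hr
  rw [hpe, hde, hre]
  have hL : (p : ℂ) * (((N.factorial : ℂ)⁻¹ ^ Fintype.card (Free (siteDeg l n))) * ((r : ℂ) * (d : ℂ))) =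
      ((p * ((((N.factorial : ℝ))⁻¹ ^ Fintype.card (Free (siteDeg l n))) * (r * d)) : ℝ) : ℂ) := by
    push_cast; ring
  have hR : (p : ℂ) * (((N.factorial : ℂ)⁻¹ ^ Fintype.card (Free (siteDeg l n))) * (((4 : ℂ)⁻¹) ^ (N * k) * (d : ℂ))) =
      ((p * ((((N.factorial : ℝ))⁻¹ ^ Fintype.card (Free (siteDeg l n))) * (((4 : ℝ)⁻¹) ^ (N * k) * d)) : ℝ) : ℂ) := by
    push_cast; ring
  rw [hL, hR, Complex.real_le_real]
  have hrle : r ≤ ((4 : ℝ)⁻¹) ^ (N * k) := by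
    refine (le_abs_self r).trans (le_of_eq ?_)
    rw [hr, show N * (2 * k) = 2 * (N * k) by ring, pow_mul]
    norm_num
  have hq0 : 0 ≤ ((N.factorial : ℝ))⁻¹ ^ Fintype.card (Free (siteDeg l n)) := pow_nonneg (inv_nonneg.2 (Nat.cast_nonneg _)) _
  nlinarith [mul_nonneg hp hq0, mul_nonneg (mul_nonneg hp hq0) hd, mul_le_mul_of_nonneg_right hrle hd]

end LoopOfCycle

/-! #### Injectivity of `(n, z) ↦ n'`: the loop is read off the patterned configuration -/

section Injective

variable {Λ : Type*} [LinearOrder Λ] [Fintype Λ] {N : ℕ}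
variable {B : Type*} [Fintype B] [DecidableEq B]

omit [DecidableEq B] in
/-- **Key reading lemma**: at a loop site `y`, the link carrying the value `patVal y` is exactly the
outgoing loop link `{y, π y}` (`N ≥ 3`, bipartite: the incoming link carries the other value, the
remaining links carry `0`). [cite: FrommForcrand2008, (6)] -/
theorem patCfg_eq_patVal_iff (h1 : 1 < N) (h3 : 3 ≤ N) (l : B → Λ × Λ) (hl : ∀ b, (l b).1 ≠ (l b).2)
    (ε : Λ → Bool) (hε : ∀ b, ε (l b).1 ≠ ε (l b).2) (n : B → Fin N) (π : Equiv.Perm Λ) (hπ : IsLoopOf l n π)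
    {y t : Λ} (hy : y ∈ π.support) (b : B) (hj : Joins l b y t) :
    patCfg h1 l ε n π b = patVal h1 ε y ↔ π y = t := by
  refine ⟨fun h => ?_, fun h => patCfg_of_joins_apply hl hπ b hj h⟩
  by_contra hne
  by_cases ht : π t = y
  · rw [patCfg_of_joins_apply_eq hl hπ b hj ht] at h
    exact patVal_ne_patVal h1 h3 ε (Adj.color_ne hε ⟨b, joins_comm.1 hj⟩) h
  · rw [patCfg_of_joins_of_ne b hj hne ht] at h
    have h0 : (n b : ℕ) = 0 := by
      rcases hj with ⟨hy1, -⟩ | ⟨-, hy2⟩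
      · exact apply_eq_zero_of_siteDeg_fst l n b (hy1 ▸ hπ.untouched y hy)
      · exact apply_eq_zero_of_siteDeg_snd l n b (hy2 ▸ hπ.untouched y hy)
    exact patVal_ne_zero h1 h3 ε y (by rw [← h, h0])

/-- **The GAIN index at `x`**: for an admissible configuration `n` leaving `x` untouched, the long baryon
loops through `x` (cyclic `z` through `x` on the untouched sites, `|supp z| ≠ 2`, every hop along a link);
empty otherwise. [cite: FrommForcrand2008, (6)] -/
def loopIdx (l : B → Λ × Λ) (x : Λ) (n : B → Fin N) : Finset (Equiv.Perm (Free (siteDeg l n))) :=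
  if h : (∀ y, siteDeg l n y = 0 ∨ siteDeg l n y = N) ∧ siteDeg l n x = 0 then
    Finset.univ.filter (fun z => (z.cycleOf ⟨x, h.2⟩ = z ∧ z ⟨x, h.2⟩ ≠ ⟨x, h.2⟩) ∧ ¬z.support.card = 2 ∧
      ∀ u ∈ z.support, Adj l u.1 (z u).1)
  else ∅

omit [DecidableEq B] in
/-- Membership in the GAIN index. [cite: FrommForcrand2008, (6)] -/
theorem mem_loopIdx_iff (l : B → Λ × Λ) (x : Λ) (n : B → Fin N) (z : Equiv.Perm (Free (siteDeg l n))) :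
    z ∈ loopIdx l x n ↔ ∃ h : (∀ y, siteDeg l n y = 0 ∨ siteDeg l n y = N) ∧ siteDeg l n x = 0,
      (z.cycleOf ⟨x, h.2⟩ = z ∧ z ⟨x, h.2⟩ ≠ ⟨x, h.2⟩) ∧ ¬z.support.card = 2 ∧ ∀ u ∈ z.support, Adj l u.1 (z u).1 := by
  unfold loopIdx
  by_cases h : (∀ y, siteDeg l n y = 0 ∨ siteDeg l n y = N) ∧ siteDeg l n x = 0
  · rw [dif_pos h]
    simp only [Finset.mem_filter, Finset.mem_univ, true_and]
    exact ⟨fun hq => ⟨h, hq⟩, fun ⟨_, hq⟩ => hq⟩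
  · rw [dif_neg h]
    simp only [Finset.notMem_empty, false_iff]
    exact fun ⟨h', _⟩ => h h'

/-- **THE MAP `(n, z) ↦ n'` IS INJECTIVE ON THE GAIN INDEX**: the loop `z` is recovered from `n'` by
following, from `x`, the links carrying the pattern value of the current site; then `n` is `n'` off the
loop. [cite: FrommForcrand2008, (6)] -/
theorem patCfg_injOn (h1 : 1 < N) (h3 : 3 ≤ N) (l : B → Λ × Λ) (hl : ∀ b, (l b).1 ≠ (l b).2)
    (ε : Λ → Bool) (hε : ∀ b, ε (l b).1 ≠ ε (l b).2) (x : Λ) :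
    Set.InjOn (fun p : (Σ n : B → Fin N, Equiv.Perm (Free (siteDeg l n))) =>
        patCfg h1 l ε p.1 (Equiv.Perm.ofSubtype p.2))
      ↑(Finset.univ.sigma (loopIdx (N := N) l x)) := by
  rintro ⟨n₁, z₁⟩ hm₁ ⟨n₂, z₂⟩ hm₂ heq
  dsimp only at heq
  obtain ⟨⟨hadm₁, hx₁⟩, hz₁, hc₁, hg₁⟩ := (mem_loopIdx_iff l x n₁ z₁).1 (Finset.mem_sigma.1 (Finset.mem_coe.1 hm₁)).2
  obtain ⟨⟨hadm₂, hx₂⟩, hz₂, hc₂, hg₂⟩ := (mem_loopIdx_iff l x n₂ z₂).1 (Finset.mem_sigma.1 (Finset.mem_coe.1 hm₂)).2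
  set π₁ := Equiv.Perm.ofSubtype z₁ with hπ₁d
  set π₂ := Equiv.Perm.ofSubtype z₂ with hπ₂d
  have hπ₁ : IsLoopOf l n₁ π₁ := isLoopOf_ofSubtype l n₁ hx₁ z₁ hz₁ hc₁ hg₁
  have hπ₂ : IsLoopOf l n₂ π₂ := isLoopOf_ofSubtype l n₂ hx₂ z₂ hz₂ hc₂ hg₂
  have hxs₁ : x ∈ π₁.support := mem_support_ofSubtype_base hx₁ z₁ hz₁
  have hxs₂ : x ∈ π₂.support := mem_support_ofSubtype_base hx₂ z₂ hz₂
  -- Step A: the iterates of `x` agree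
  have hiter : ∀ i : ℕ, (π₁ ^ i) x = (π₂ ^ i) x := by
    intro i
    induction i with
    | zero => simp
    | succ i ih =>
      rw [pow_succ', pow_succ', Equiv.Perm.mul_apply, Equiv.Perm.mul_apply, ← ih]
      set u := (π₁ ^ i) x with hu
      have hu₁ : u ∈ π₁.support := Equiv.Perm.pow_apply_mem_support.2 hxs₁
      have hu₂ : u ∈ π₂.support := by rw [ih]; exact Equiv.Perm.pow_apply_mem_support.2 hxs₂
      obtain ⟨b, hb⟩ := hπ₁.adj u hu₁
      have hval : patCfg h1 l ε n₁ π₁ b = patVal h1 ε u := patCfg_of_joins_apply hl hπ₁ b hb rfl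
      rw [heq] at hval
      exact ((patCfg_eq_patVal_iff h1 h3 l hl ε hε n₂ π₂ hπ₂ hu₂ b hb).1 hval).symm
  -- Step B: the walks agree
  have hperm : π₁ = π₂ := by
    ext y
    by_cases hy : y ∈ π₁.support
    · obtain ⟨i, hi⟩ := exists_pow_apply_base hx₁ z₁ hz₁ hy
      have h1' : π₁ y = (π₁ ^ (i + 1)) x := by rw [pow_succ', Equiv.Perm.mul_apply, hi]
      have h2' : π₂ y = (π₂ ^ (i + 1)) x := by rw [pow_succ', Equiv.Perm.mul_apply, ← hiter i, hi]
      rw [h1', h2', hiter]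
    · have hy₂ : y ∉ π₂.support := by
        intro hy₂
        obtain ⟨i, hi⟩ := exists_pow_apply_base hx₂ z₂ hz₂ hy₂
        rw [← hiter i] at hi
        exact hy (hi ▸ Equiv.Perm.pow_apply_mem_support.2 hxs₁)
      rw [Equiv.Perm.notMem_support.1 hy, Equiv.Perm.notMem_support.1 hy₂]
  -- Step C: the configurations agree
  have hn : n₁ = n₂ := by
    funext b
    by_cases hb : π₁ (l b).1 = (l b).2 ∨ π₁ (l b).2 = (l b).1
    · -- a loop link: untouched in both
      apply Fin.ext
      have e₁ : ((n₁ b : Fin N) : ℕ) = 0 := by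
        rcases hb with h | h
        · exact apply_eq_zero_of_siteDeg_fst l n₁ b (hπ₁.untouched _ (Equiv.Perm.mem_support.2 (by rw [h]; exact (hl b).symm)))
        · exact apply_eq_zero_of_siteDeg_snd l n₁ b (hπ₁.untouched _ (Equiv.Perm.mem_support.2 (by rw [h]; exact hl b)))
      rw [hperm] at hb
      have e₂ : ((n₂ b : Fin N) : ℕ) = 0 := by
        rcases hb with h | h
        · exact apply_eq_zero_of_siteDeg_fst l n₂ b (hπ₂.untouched _ (Equiv.Perm.mem_support.2 (by rw [h]; exact (hl b).symm)))
        · exact apply_eq_zero_of_siteDeg_snd l n₂ b (hπ₂.untouched _ (Equiv.Perm.mem_support.2 (by rw [h]; exact hl b)))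
      rw [e₁, e₂]
    · have e₁ : patCfg h1 l ε n₁ π₁ b = n₁ b := patCfg_of_ne b (fun h => hb (Or.inl h)) (fun h => hb (Or.inr h))
      rw [hperm] at hb
      have e₂ : patCfg h1 l ε n₂ π₂ b = n₂ b := patCfg_of_ne b (fun h => hb (Or.inl h)) (fun h => hb (Or.inr h))
      rw [← e₁, ← e₂, heq]
  subst hn
  have hz : z₁ = z₂ := Equiv.Perm.ofSubtype_injective hperm
  subst hz
  rfl

end Injective

/-! ### Stage B15: the Schwinger–Dyson bound for `SU(N)`, `N` odd `≥ 3` — the `N`-fold dimers at `x`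
dominate the baryon loops of length `≥ 4` through `x` -/

section SchwingerDysonSU

variable {Λ : Type*} [LinearOrder Λ] [Fintype Λ] {N : ℕ}
variable {B : Type*} [Fintype B] [DecidableEq B]

open scoped ComplexOrder in
/-- **The mesonic part of the Schwinger–Dyson sum exceeds `8N` times the dimer weight at `x`**:
`∑_{b∋x} ∑_{n adm} 4 n_b (N+1-n_b) W(n) ≥ 8N ∑_{n adm, d_n(x) = N} W(n)` (`n_b ≤ N - 1`). [cite: SalmhoferSeiler1991, Lemma 4.7 (4.38)] [cite: FrommForcrand2008, (6)] -/
theorem sum_nbr_sdCoeff_ge (hN : Odd N) (l : B → Λ × Λ) (hl : ∀ b, (l b).1 ≠ (l b).2) (Γ : B → ℂ)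
    (hΓ : ∀ b, Γ b = 1 ∨ Γ b = -1) (x : Λ) :
    8 * (N : ℂ) * ∑ n : B → Fin N, (if (∀ x', siteDeg l n x' = 0 ∨ siteDeg l n x' = N) ∧ siteDeg l n x = N then zWeight N l Γ n else 0) ≤
      ∑ b ∈ Finset.univ.filter (fun b => (l b).1 = x ∨ (l b).2 = x),
        ∑ n : B → Fin N, (if (∀ x', siteDeg l n x' = 0 ∨ siteDeg l n x' = N) then
          (4 * ((n b : ℕ) : ℂ) * ((N : ℂ) + 1 - (n b : ℕ))) * zWeight N l Γ n else 0) := by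
  set nbr := Finset.univ.filter (fun b => (l b).1 = x ∨ (l b).2 = x) with hnbr
  have hcoef : ∀ (n : B → Fin N) (b : B), ((N : ℂ) + 1 - (n b : ℕ)) = (((N + 1 - (n b : ℕ) : ℕ)) : ℂ) := fun n b => by
    rw [Nat.cast_sub (by have := (n b).2; omega)]; push_cast; ring
  have hfnn : ∀ (n : B → Fin N) (b : B), (0 : ℂ) ≤ 4 * ((n b : ℕ) : ℂ) * ((N : ℂ) + 1 - (n b : ℕ)) := fun n b => by
    rw [hcoef]; exact mul_nonneg (mul_nonneg (by norm_num) (Nat.cast_nonneg _)) (Nat.cast_nonneg _)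
  rw [Finset.mul_sum, Finset.sum_comm]
  refine Finset.sum_le_sum fun n _ => ?_
  by_cases hadm : ∀ x', siteDeg l n x' = 0 ∨ siteDeg l n x' = N
  · have hsum : ∑ b ∈ nbr, (if (∀ x', siteDeg l n x' = 0 ∨ siteDeg l n x' = N) then
          (4 * ((n b : ℕ) : ℂ) * ((N : ℂ) + 1 - (n b : ℕ))) * zWeight N l Γ n else 0) =
        (∑ b ∈ nbr, 4 * ((n b : ℕ) : ℂ) * ((N : ℂ) + 1 - (n b : ℕ))) * zWeight N l Γ n := by
      rw [Finset.sum_mul]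
      exact Finset.sum_congr rfl fun b _ => by rw [if_pos hadm]
    rw [hsum]
    by_cases hx : siteDeg l n x = N
    · rw [if_pos ⟨hadm, hx⟩]
      refine mul_le_mul_of_nonneg_right ?_ (zWeight_nonneg hN l Γ hΓ n)
      have hdeg : ((N : ℕ) : ℂ) = ∑ b ∈ nbr, ((n b : ℕ) : ℂ) := by
        have h := congrArg (Nat.cast : ℕ → ℂ) hx
        rw [siteDeg_eq_sum_filter l hl n x, Nat.cast_sum] at h
        exact h.symm
      calc 8 * (N : ℂ) = ∑ b ∈ nbr, 8 * ((n b : ℕ) : ℂ) := by rw [← Finset.mul_sum, ← hdeg]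
        _ ≤ ∑ b ∈ nbr, 4 * ((n b : ℕ) : ℂ) * ((N : ℂ) + 1 - (n b : ℕ)) := Finset.sum_le_sum fun b _ => by
            rw [hcoef, show (8 : ℂ) * ((n b : ℕ) : ℂ) = 4 * ((n b : ℕ) : ℂ) * ((2 : ℕ) : ℂ) by push_cast; ring]
            exact mul_le_mul_of_nonneg_left (Nat.cast_le.2 (by have := (n b).2; omega))
              (mul_nonneg (by norm_num) (Nat.cast_nonneg _))
    · rw [if_neg fun h => hx h.2, mul_zero]
      exact mul_nonneg (Finset.sum_nonneg fun b _ => hfnn n b) (zWeight_nonneg hN l Γ hΓ n)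
  · rw [if_neg fun h => hadm h.1, mul_zero]
    exact Finset.sum_nonneg fun b _ => by rw [if_neg hadm]

variable (N) in
/-- **The signed sum of the long baryon loops through `x`** for the configuration `n` (length `≠ 2`; `0` if
`x` is touched): `∑_{z cyclic through x, |supp z| ≠ 2} cycTerm z`. [cite: FrommForcrand2008, (6)] -/
def longLoops (l : B → Λ × Λ) (Γ : B → ℂ) (n : B → Fin N) (x : Λ) : ℂ :=
  if h : siteDeg l n x = 0 then
    ∑ z ∈ Finset.univ.filter (fun z : Equiv.Perm (Free (siteDeg l n)) =>
      (z.cycleOf ⟨x, h⟩ = z ∧ z ⟨x, h⟩ ≠ ⟨x, h⟩) ∧ ¬z.support.card = 2), cycTerm N l Γ (siteDeg l n) z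
  else 0

/-- **THE BARYONIC WEIGHT AT `x` = `N`-FOLD DIMERS AT `x` + LONG LOOPS THROUGH `x`**:
`∑_{n adm, d_n(x)=0} W(n) = 4^{-N} ∑_{b∋x} ∑_{n : n_b = 0, adm, x_b,y_b ∈ S(n)} w(n)(N!)^{-|S(n)|} det K̃(d_n + N e_b)
  + ∑_{n adm, d_n(x)=0} w(n)(N!)^{-|S(n)|} longLoops(n, x)` (simple link set, `Γ = ±1`, `N` odd). [cite: FrommForcrand2008, (5)–(6)] -/
theorem baryonic_eq_twoCycle_add_longLoops (hN : Odd N) (l : B → Λ × Λ) (hl : ∀ b, (l b).1 ≠ (l b).2)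
    (hsimp : ∀ b b', Joins l b' (l b).1 (l b).2 → b' = b) (Γ : B → ℂ) (hΓ : ∀ b, Γ b = 1 ∨ Γ b = -1) (x : Λ) :
    ∑ n : B → Fin N, (if (∀ x', siteDeg l n x' = 0 ∨ siteDeg l n x' = N) ∧ siteDeg l n x = 0 then zWeight N l Γ n else 0) =
      ((4 : ℂ)⁻¹) ^ N *
          ∑ b ∈ Finset.univ.filter (fun b => (l b).1 = x ∨ (l b).2 = x),
            ∑ n : B → Fin N, (if (n b : ℕ) = 0 ∧ ((∀ x', siteDeg l n x' = 0 ∨ siteDeg l n x' = N) ∧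
                siteDeg l n (l b).1 = 0 ∧ siteDeg l n (l b).2 = 0) then
              (∏ b', dimerCoeff N (n b')) *
                ((N.factorial : ℂ)⁻¹ ^ Fintype.card (Free (siteDeg l n)) *
                  (Kred N l Γ (fun y => siteDeg l n y + N * bondObs l b y)).det) else 0) +
        ∑ n : B → Fin N, (if (∀ x', siteDeg l n x' = 0 ∨ siteDeg l n x' = N) ∧ siteDeg l n x = 0 then
          (∏ b', dimerCoeff N (n b')) * ((N.factorial : ℂ)⁻¹ ^ Fintype.card (Free (siteDeg l n)) * longLoops N l Γ n x) else 0) := by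
  set nbr := Finset.univ.filter (fun b => (l b).1 = x ∨ (l b).2 = x) with hnbr
  rw [Finset.sum_comm, Finset.mul_sum, ← Finset.sum_add_distrib]
  refine Finset.sum_congr rfl fun n _ => ?_
  by_cases h : (∀ x', siteDeg l n x' = 0 ∨ siteDeg l n x' = N) ∧ siteDeg l n x = 0
  · -- rewrite the inner `b`-sum
    have hinner : ∑ b ∈ nbr, (if (n b : ℕ) = 0 ∧ ((∀ x', siteDeg l n x' = 0 ∨ siteDeg l n x' = N) ∧
          siteDeg l n (l b).1 = 0 ∧ siteDeg l n (l b).2 = 0) then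
        (∏ b', dimerCoeff N (n b')) *
          ((N.factorial : ℂ)⁻¹ ^ Fintype.card (Free (siteDeg l n)) *
            (Kred N l Γ (fun y => siteDeg l n y + N * bondObs l b y)).det) else 0) =
        (∏ b', dimerCoeff N (n b')) * ((N.factorial : ℂ)⁻¹ ^ Fintype.card (Free (siteDeg l n)) *
          ∑ b ∈ nbr, (if siteDeg l n (l b).1 = 0 ∧ siteDeg l n (l b).2 = 0 then
            (Kred N l Γ (fun y => siteDeg l n y + N * bondObs l b y)).det else 0)) := by
      rw [Finset.mul_sum, Finset.mul_sum]
      refine Finset.sum_congr rfl fun b hb => ?_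
      have hbx := (Finset.mem_filter.1 hb).2
      by_cases he : siteDeg l n (l b).1 = 0 ∧ siteDeg l n (l b).2 = 0
      · have h0 : (n b : ℕ) = 0 := apply_eq_zero_of_siteDeg_fst l n b he.1
        rw [if_pos ⟨h0, h.1, he⟩, if_pos he]
      · rw [if_neg fun h' => he h'.2.2, if_neg he, mul_zero, mul_zero]
    rw [if_pos h, if_pos h, hinner, zWeight, longLoops, dif_pos h.2, det_Kred_eq_sum_cycTerm hN l Γ _ ⟨x, h.2⟩,
      ← Finset.sum_filter_add_sum_filter_not _ (fun z : Equiv.Perm (Free (siteDeg l n)) => z.support.card = 2),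
      Finset.filter_filter, Finset.filter_filter, sum_twoCycle_eq hN l hl hsimp Γ hΓ h.2]
    ring
  · rw [if_neg h, if_neg h, add_zero]
    symm
    rw [mul_eq_zero]; right
    refine Finset.sum_eq_zero fun b hb => ?_
    have hbx := (Finset.mem_filter.1 hb).2
    rw [if_neg]
    rintro ⟨-, hadm, h1', h2'⟩
    rcases hbx with hb1 | hb2
    · exact h ⟨hadm, hb1 ▸ h1'⟩
    · exact h ⟨hadm, hb2 ▸ h2'⟩

omit [DecidableEq B] in
/-- A cyclic permutation that does not hop along links contributes nothing. [cite: FrommForcrand2008, (5)–(6)] -/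
theorem cycTerm_eq_zero_of_not_graph (l : B → Λ × Λ) (Γ : B → ℂ) {D : Λ → ℕ} (z : Equiv.Perm (Free D))
    (h : ¬∀ u ∈ z.support, Adj l u.1 (z u).1) : cycTerm N l Γ D z = 0 := by
  obtain ⟨u, hu⟩ := not_forall.1 h
  obtain ⟨hu, hna⟩ := Classical.not_imp.1 hu
  have h0 : Kred N l Γ D (z u) u = 0 :=
    Kred_apply_eq_zero_of_not_adj l Γ D (z u) u fun b =>
      ⟨fun hb => hna ⟨b, Or.inr hb⟩, fun hb => hna ⟨b, Or.inl hb⟩⟩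
  rw [cycTerm, Finset.prod_eq_zero (f := fun i => Kred N l Γ D (z i) i) hu h0, mul_zero, zero_mul]

open scoped ComplexOrder in
/-- **THE `N`-FOLD DIMERS AT `x` DOMINATE THE LONG BARYON LOOPS THROUGH `x`** (`N` odd `≥ 3`, simple
bipartite link set, `Γ = ±1`):
`∑_{n adm, d_n(x)=0} w(n)(N!)^{-|S(n)|} longLoops(n,x) ≤ ∑_{n adm, d_n(x)=N} W(n)` — by the injection
`(n, z) ↦ n'` closing each loop with the alternating `1`/`N-1` pattern (`weight_mul_cycTerm_le_zWeight_patCfg`,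
`patCfg_injOn`). [cite: FrommForcrand2008, (5)–(6)] [cite: SalmhoferSeiler1991, Lemma 4.7 (4.38) & §5 p. 424] -/
theorem longLoops_le_dimer (hN : Odd N) (h3 : 3 ≤ N) (l : B → Λ × Λ) (hl : ∀ b, (l b).1 ≠ (l b).2)
    (hsimp : ∀ b b', Joins l b' (l b).1 (l b).2 → b' = b) (ε : Λ → Bool) (hε : ∀ b, ε (l b).1 ≠ ε (l b).2)
    (Γ : B → ℂ) (hΓ : ∀ b, Γ b = 1 ∨ Γ b = -1) (x : Λ) :
    ∑ n : B → Fin N, (if (∀ x', siteDeg l n x' = 0 ∨ siteDeg l n x' = N) ∧ siteDeg l n x = 0 then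
        (∏ b', dimerCoeff N (n b')) * ((N.factorial : ℂ)⁻¹ ^ Fintype.card (Free (siteDeg l n)) * longLoops N l Γ n x) else 0) ≤
      ∑ n : B → Fin N, (if (∀ x', siteDeg l n x' = 0 ∨ siteDeg l n x' = N) ∧ siteDeg l n x = N then zWeight N l Γ n else 0) := by
  have h1 : 1 < N := lt_of_lt_of_le (by norm_num) h3
  -- Step 1: termwise, LOSS(n) ≤ ∑_{z ∈ loopIdx n} W(n'(n, z))
  have step1 : ∀ n : B → Fin N,
      (if (∀ x', siteDeg l n x' = 0 ∨ siteDeg l n x' = N) ∧ siteDeg l n x = 0 then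
        (∏ b', dimerCoeff N (n b')) * ((N.factorial : ℂ)⁻¹ ^ Fintype.card (Free (siteDeg l n)) * longLoops N l Γ n x) else 0) ≤
      ∑ z ∈ loopIdx l x n, zWeight N l Γ (patCfg h1 l ε n (Equiv.Perm.ofSubtype z)) := by
    intro n
    by_cases h : (∀ x', siteDeg l n x' = 0 ∨ siteDeg l n x' = N) ∧ siteDeg l n x = 0
    · have hidx : loopIdx l x n = (Finset.univ.filter (fun z : Equiv.Perm (Free (siteDeg l n)) =>
          (z.cycleOf ⟨x, h.2⟩ = z ∧ z ⟨x, h.2⟩ ≠ ⟨x, h.2⟩) ∧ ¬z.support.card = 2)).filter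
            (fun z => ∀ u ∈ z.support, Adj l u.1 (z u).1) := by
        rw [loopIdx, dif_pos h, Finset.filter_filter]
        exact Finset.filter_congr fun z _ => by simp only [and_assoc]
      rw [if_pos h, longLoops, dif_pos h.2, Finset.mul_sum, Finset.mul_sum, hidx,
        ← Finset.sum_filter_add_sum_filter_not _ (fun z : Equiv.Perm (Free (siteDeg l n)) => ∀ u ∈ z.support, Adj l u.1 (z u).1),
        Finset.sum_eq_zero (s := (Finset.univ.filter (fun z : Equiv.Perm (Free (siteDeg l n)) =>
          (z.cycleOf ⟨x, h.2⟩ = z ∧ z ⟨x, h.2⟩ ≠ ⟨x, h.2⟩) ∧ ¬z.support.card = 2)).filter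
            (fun z => ¬∀ u ∈ z.support, Adj l u.1 (z u).1))
          (fun z hz => by rw [cycTerm_eq_zero_of_not_graph l Γ z (Finset.mem_filter.1 hz).2, mul_zero, mul_zero]),
        add_zero]
      refine Finset.sum_le_sum fun z hz => ?_
      obtain ⟨hz1, hg1⟩ := Finset.mem_filter.1 hz
      obtain ⟨-, hz2, hc2⟩ := Finset.mem_filter.1 hz1
      exact weight_mul_cycTerm_le_zWeight_patCfg hN h3 l hl hsimp ε hε Γ hΓ n z
        (isLoopOf_ofSubtype l n h.2 z hz2 hc2 hg1)
    · rw [if_neg h, loopIdx, dif_neg h, Finset.sum_empty]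
  -- Step 2: re-index by the (injective) image
  have hsig := Finset.sum_sigma Finset.univ (loopIdx (N := N) l x)
    (fun p => zWeight N l Γ (patCfg h1 l ε p.1 (Equiv.Perm.ofSubtype p.2)))
  have himg := Finset.sum_image (f := fun n' => zWeight N l Γ n') (patCfg_injOn h1 h3 l hl ε hε x)
  have hsub : (Finset.univ.sigma (loopIdx (N := N) l x)).image
      (fun p : (Σ n : B → Fin N, Equiv.Perm (Free (siteDeg l n))) => patCfg h1 l ε p.1 (Equiv.Perm.ofSubtype p.2)) ⊆
      Finset.univ.filter (fun n' : B → Fin N => (∀ x', siteDeg l n' x' = 0 ∨ siteDeg l n' x' = N) ∧ siteDeg l n' x = N) := by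
    intro n' hn'
    obtain ⟨⟨n, z⟩, hp, rfl⟩ := Finset.mem_image.1 hn'
    obtain ⟨⟨hadm, hx⟩, hz, hc, hgr⟩ := (mem_loopIdx_iff l x n z).1 (Finset.mem_sigma.1 hp).2
    have hπ := isLoopOf_ofSubtype l n hx z hz hc hgr
    refine Finset.mem_filter.2 ⟨Finset.mem_univ _, fun y => patCfg_adm h1 l hl hsimp ε hε n hadm _ hπ y, ?_⟩
    exact siteDeg_patCfg_of_mem h1 l hl hsimp ε hε n _ hπ (mem_support_ofSubtype_base hx z hz)
  calc ∑ n : B → Fin N, (if (∀ x', siteDeg l n x' = 0 ∨ siteDeg l n x' = N) ∧ siteDeg l n x = 0 then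
        (∏ b', dimerCoeff N (n b')) * ((N.factorial : ℂ)⁻¹ ^ Fintype.card (Free (siteDeg l n)) * longLoops N l Γ n x) else 0)
      ≤ ∑ n : B → Fin N, ∑ z ∈ loopIdx l x n, zWeight N l Γ (patCfg h1 l ε n (Equiv.Perm.ofSubtype z)) :=
        Finset.sum_le_sum fun n _ => step1 n
    _ = ∑ p ∈ Finset.univ.sigma (loopIdx (N := N) l x), zWeight N l Γ (patCfg h1 l ε p.1 (Equiv.Perm.ofSubtype p.2)) :=
        hsig.symm
    _ = ∑ n' ∈ (Finset.univ.sigma (loopIdx (N := N) l x)).image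
          (fun p : (Σ n : B → Fin N, Equiv.Perm (Free (siteDeg l n))) => patCfg h1 l ε p.1 (Equiv.Perm.ofSubtype p.2)),
          zWeight N l Γ n' := himg.symm
    _ ≤ ∑ n' ∈ Finset.univ.filter (fun n' : B → Fin N => (∀ x', siteDeg l n' x' = 0 ∨ siteDeg l n' x' = N) ∧ siteDeg l n' x = N),
          zWeight N l Γ n' := Finset.sum_le_sum_of_subset_of_nonneg hsub (fun n' _ _ => zWeight_nonneg hN l Γ hΓ n')
    _ = _ := by rw [Finset.sum_filter]

open scoped ComplexOrder in
/-- **THE SCHWINGER–DYSON LOWER BOUND FOR `SU(N)`, `N` ODD `≥ 3`, AT `β = 0`, `m = 0`** (one staggered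
flavour; any finite SIMPLE BIPARTITE link set with distinct endpoints and signs `Γ_b = ±1`): for every site `x`,

  `4N · σ_Λ Z ≤ ∑_{b ∋ x} σ_Λ ∫ e^{-S_F} ψ̄ψ(x_b) ψ̄ψ(y_b)`,

i.e. in Salmhofer–Seiler's units `σ = ψ̄ψ/(2N)`: `∑_{y∼x} [σ_x σ_y] ≥ (1/N)·Z` — their Lemma 4.7 / (4.38)
with `K(N)` replaced by `N`, now for `SU(N)` despite the baryon loops.  Proof: the exact per-bond
decomposition `sd_bond_eq_topDimer`, the mesonic excess `≥ 8N × (dimer weight at x)` (`sum_nbr_sdCoeff_ge`),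
the baryonic weight at `x` = `N`-fold dimers + long loops (`baryonic_eq_twoCycle_add_longLoops`), and the
domination of the long loops by the dimer weight (`longLoops_le_dimer`).  Honest framing: `β = 0`, finite
volume, `N` odd `≥ 3` (for `SU(2)` the bound fails), bipartite simple link sets (e.g. the staggered even
torus of side `≥ 4` with any sign twists); nothing about `β > 0`, the thermodynamic limit or the continuum. [cite: SalmhoferSeiler1991, Lemma 4.7 (4.38) & §5 p. 424] [cite: FrommForcrand2008, (5)–(7)] -/
theorem sd_site_lower_bound_SU (hN : Odd N) (h3 : 3 ≤ N) (l : B → Λ × Λ) (hl : ∀ b, (l b).1 ≠ (l b).2)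
    (hsimp : ∀ b b', Joins l b' (l b).1 (l b).2 → b' = b) (ε : Λ → Bool) (hε : ∀ b, ε (l b).1 ≠ ε (l b).2)
    (Γ : B → ℂ) (hΓ : ∀ b, Γ b = 1 ∨ Γ b = -1) (x : Λ) :
    4 * (N : ℂ) * (sgn (Fintype.card (CIdx Λ N)) * fermiZSU (N := N) l Γ 0) ≤
      ∑ b ∈ Finset.univ.filter (fun b => (l b).1 = x ∨ (l b).2 = x),
        sgn (Fintype.card (CIdx Λ N)) * fermiBracketSU l Γ 0 (fun _ => (meson (l b).1 * meson (l b).2 : FermiAlg Λ N)) := by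
  have hΓ2 : ∀ b, Γ b ^ 2 = 1 := fun b => by rcases hΓ b with h | h <;> simp [h]
  set nbr := Finset.univ.filter (fun b => (l b).1 = x ∨ (l b).2 = x) with hnbr
  set F : ℂ := (N.factorial : ℂ) ^ Fintype.card Λ with hF
  set Dim := ∑ n : B → Fin N, (if (∀ x', siteDeg l n x' = 0 ∨ siteDeg l n x' = N) ∧ siteDeg l n x = N then
    zWeight N l Γ n else 0) with hDim
  set Bar := ∑ n : B → Fin N, (if (∀ x', siteDeg l n x' = 0 ∨ siteDeg l n x' = N) ∧ siteDeg l n x = 0 then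
    zWeight N l Γ n else 0) with hBar
  set A := ∑ b ∈ nbr, ∑ n : B → Fin N, (if (∀ x', siteDeg l n x' = 0 ∨ siteDeg l n x' = N) then
    (4 * ((n b : ℕ) : ℂ) * ((N : ℂ) + 1 - (n b : ℕ))) * zWeight N l Γ n else 0) with hA
  set T := ∑ b ∈ nbr, ∑ n : B → Fin N, (if (n b : ℕ) = 0 ∧ ((∀ x', siteDeg l n x' = 0 ∨ siteDeg l n x' = N) ∧
      siteDeg l n (l b).1 = 0 ∧ siteDeg l n (l b).2 = 0) then
    (∏ b', dimerCoeff N (n b')) * ((N.factorial : ℂ)⁻¹ ^ Fintype.card (Free (siteDeg l n)) *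
      (Kred N l Γ (fun y => siteDeg l n y + N * bondObs l b y)).det) else 0) with hT
  set LT := ∑ n : B → Fin N, (if (∀ x', siteDeg l n x' = 0 ∨ siteDeg l n x' = N) ∧ siteDeg l n x = 0 then
    (∏ b', dimerCoeff N (n b')) * ((N.factorial : ℂ)⁻¹ ^ Fintype.card (Free (siteDeg l n)) * longLoops N l Γ n x) else 0)
    with hLT
  -- the four inputs
  have hRHS : ∑ b ∈ nbr, sgn (Fintype.card (CIdx Λ N)) *
      fermiBracketSU l Γ 0 (fun _ => (meson (l b).1 * meson (l b).2 : FermiAlg Λ N)) =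
      F * A + 4 * (N : ℂ) * ((4 : ℂ)⁻¹) ^ N * (F * T) := by
    rw [hA, hT, Finset.mul_sum, Finset.mul_sum, Finset.mul_sum, ← Finset.sum_add_distrib]
    exact Finset.sum_congr rfl fun b _ => by rw [sd_bond_eq_topDimer hN l hl Γ hΓ2 b]; ring
  have hZ : sgn (Fintype.card (CIdx Λ N)) * fermiZSU (N := N) l Γ 0 = F * Dim + F * Bar :=
    sgn_mul_fermiZSU_eq_dimer_add_baryonic hN l hl Γ hΓ2 x
  have hA8 : 8 * (N : ℂ) * Dim ≤ A := sum_nbr_sdCoeff_ge hN l hl Γ hΓ x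
  have hBarEq : Bar = ((4 : ℂ)⁻¹) ^ N * T + LT := baryonic_eq_twoCycle_add_longLoops hN l hl hsimp Γ hΓ x
  have hLT : LT ≤ Dim := longLoops_le_dimer hN h3 l hl hsimp ε hε Γ hΓ x
  -- assemble
  have hFnn : 0 ≤ F := pow_nonneg (Nat.cast_nonneg _) _
  have hNnn : (0 : ℂ) ≤ 4 * (N : ℂ) := mul_nonneg (by norm_num) (Nat.cast_nonneg _)
  rw [← sub_nonneg]
  have hid : ∑ b ∈ nbr, sgn (Fintype.card (CIdx Λ N)) *
        fermiBracketSU l Γ 0 (fun _ => (meson (l b).1 * meson (l b).2 : FermiAlg Λ N)) -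
      4 * (N : ℂ) * (sgn (Fintype.card (CIdx Λ N)) * fermiZSU (N := N) l Γ 0) =
      F * (A - 8 * (N : ℂ) * Dim) + 4 * (N : ℂ) * (F * (Dim - LT)) := by
    rw [hRHS, hZ, hBarEq]; ring
  rw [hid]
  exact add_nonneg (mul_nonneg hFnn (sub_nonneg.2 hA8)) (mul_nonneg hNnn (mul_nonneg hFnn (sub_nonneg.2 hLT)))

open scoped ComplexOrder in
/-- **THE SAME IN EXPECTATIONS**: if `Z ≠ 0`, `∑_{b ∋ x} ⟨ψ̄ψ(x_b) ψ̄ψ(y_b)⟩_Λ ≥ 4N` for `SU(N)`, `N` odd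
`≥ 3`, `β = 0`, `m = 0`, on any finite simple bipartite link set with `Γ_b = ±1` — in Salmhofer–Seiler's
units `∑_{y∼x}⟨σ_xσ_y⟩ ≥ 1/N`, the input of their Theorem 4.8 (with the infrared bound) for chiral
long-range order.  Honest framing as above; nothing about `β > 0`. [cite: SalmhoferSeiler1991, Lemma 4.7 (4.38), Thm 4.8 & §5 p. 424] [cite: FrommForcrand2008, (5)–(7)] -/
theorem sum_nbr_fermiExpectSU_ge (hN : Odd N) (h3 : 3 ≤ N) (l : B → Λ × Λ) (hl : ∀ b, (l b).1 ≠ (l b).2)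
    (hsimp : ∀ b b', Joins l b' (l b).1 (l b).2 → b' = b) (ε : Λ → Bool) (hε : ∀ b, ε (l b).1 ≠ ε (l b).2)
    (Γ : B → ℂ) (hΓ : ∀ b, Γ b = 1 ∨ Γ b = -1) (x : Λ) (hZ : fermiZSU (N := N) l Γ 0 ≠ 0) :
    4 * (N : ℂ) ≤ ∑ b ∈ Finset.univ.filter (fun b => (l b).1 = x ∨ (l b).2 = x),
        fermiExpectSU l Γ 0 (fun _ => (meson (l b).1 * meson (l b).2 : FermiAlg Λ N)) := by
  have hσ := sgn_ne_zero (Fintype.card (CIdx Λ N))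
  have hZnn := sgn_mul_fermiZSU_nonneg hN l hl Γ hΓ
  obtain ⟨hre, him⟩ := Complex.nonneg_iff.1 hZnn
  set ζ : ℝ := (sgn (Fintype.card (CIdx Λ N)) * fermiZSU (N := N) l Γ 0).re with hζ
  have hZeq : sgn (Fintype.card (CIdx Λ N)) * fermiZSU (N := N) l Γ 0 = (ζ : ℂ) :=
    Complex.ext (by simp only [Complex.ofReal_re, hζ]) (by rw [Complex.ofReal_im]; exact him.symm)
  have hζpos : 0 < ζ := by
    rcases lt_or_eq_of_le hre with h | h
    · exact h
    · exfalso
      have : sgn (Fintype.card (CIdx Λ N)) * fermiZSU (N := N) l Γ 0 = 0 := by rw [hZeq, ← h, Complex.ofReal_zero]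
      exact (mul_ne_zero hσ hZ) this
  have hsum : ∑ b ∈ Finset.univ.filter (fun b => (l b).1 = x ∨ (l b).2 = x),
        fermiExpectSU l Γ 0 (fun _ => (meson (l b).1 * meson (l b).2 : FermiAlg Λ N)) =
      (∑ b ∈ Finset.univ.filter (fun b => (l b).1 = x ∨ (l b).2 = x),
        sgn (Fintype.card (CIdx Λ N)) * fermiBracketSU l Γ 0 (fun _ => (meson (l b).1 * meson (l b).2 : FermiAlg Λ N))) *
          ((ζ : ℂ))⁻¹ := by
    rw [Finset.sum_mul]
    refine Finset.sum_congr rfl fun b _ => ?_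
    rw [fermiExpectSU, ← mul_div_mul_left _ _ hσ, hZeq, div_eq_mul_inv]
  have hmain := sd_site_lower_bound_SU hN h3 l hl hsimp ε hε Γ hΓ x
  rw [hZeq] at hmain
  have hinv : (0 : ℂ) ≤ ((ζ : ℂ))⁻¹ := by rw [← Complex.ofReal_inv]; exact Complex.zero_le_real.2 (inv_nonneg.2 hζpos.le)
  have hζne : (ζ : ℂ) ≠ 0 := Complex.ofReal_ne_zero.2 hζpos.ne'
  calc 4 * (N : ℂ) = 4 * (N : ℂ) * (ζ : ℂ) * ((ζ : ℂ))⁻¹ := by rw [mul_assoc, mul_inv_cancel₀ hζne, mul_one]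
    _ ≤ _ := by rw [hsum]; exact mul_le_mul_of_nonneg_right hmain hinv

end SchwingerDysonSU

/-! ### `Z(m = 0) > 0` from one saturating configuration; the unconditional expectation form -/

section Saturating

variable {Λ : Type*} [LinearOrder Λ] [Fintype Λ] {N : ℕ}
variable {B : Type*} [Fintype B] [DecidableEq B]

/-- The dimer coefficients are positive. [cite: FrommForcrand2008, (5)] -/
theorem dimerCoeffR_pos (j : ℕ) : 0 < ((N - j).factorial : ℝ) / ((N.factorial : ℝ) * (j.factorial : ℝ)) * (1 / 4 : ℝ) ^ j := by
  positivity

open scoped ComplexOrder in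
/-- **`Z(m = 0) > 0` AS SOON AS ONE ADMISSIBLE CONFIGURATION SATURATES EVERY SITE** (`N` odd, `Γ = ±1`):
`σ_Λ Z ≥ (N!)^{|Λ|} w(n₀) > 0` for any `n₀` with `d_{n₀} ≡ N` (no untouched site: empty baryon
determinant) — e.g. `N-1` dimers on one perfect matching and `1` on a disjoint one. [cite: FrommForcrand2008, (6)–(7)] [cite: Cayley1849, pp. 93–96] -/
theorem sgn_mul_fermiZSU_zero_pos_of_saturating (hN : Odd N) (l : B → Λ × Λ) (hl : ∀ b, (l b).1 ≠ (l b).2)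
    (Γ : B → ℂ) (hΓ : ∀ b, Γ b = 1 ∨ Γ b = -1) (n₀ : B → Fin N) (h₀ : ∀ y, siteDeg l n₀ y = N) :
    0 < sgn (Fintype.card (CIdx Λ N)) * fermiZSU (N := N) l Γ 0 := by
  have hΓ2 : ∀ b, Γ b ^ 2 = 1 := fun b => by rcases hΓ b with h | h <;> simp [h]
  rw [fermiZSU_eq_sum_det_red hN l hl Γ hΓ2, ← mul_assoc, ← mul_assoc, sgn_mul_self, one_mul]
  refine mul_pos (pow_pos (Nat.cast_pos.2 (Nat.factorial_pos N)) _) ?_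
  have hnonneg : ∀ n ∈ (Finset.univ : Finset (B → Fin N)),
      (0 : ℂ) ≤ (if (∀ x, siteDeg l n x = 0 ∨ siteDeg l n x = N) then
        (∏ b, dimerCoeff N (n b)) * ((N.factorial : ℂ)⁻¹ ^ Fintype.card (Free (siteDeg l n)) * (Kred N l Γ (siteDeg l n)).det)
        else 0) := fun n _ => by
    split_ifs
    · exact term_nonneg hN l Γ hΓ n _
    · exact le_rfl
  refine lt_of_lt_of_le ?_ (Finset.single_le_sum hnonneg (Finset.mem_univ n₀))
  rw [if_pos fun y => Or.inr (h₀ y)]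
  haveI : IsEmpty (Free (siteDeg l n₀)) := ⟨fun u => absurd u.2 (by rw [h₀ u.1]; exact hN.pos.ne')⟩
  rw [Matrix.det_isEmpty, Fintype.card_eq_zero, pow_zero, mul_one, mul_one,
    Finset.prod_congr rfl fun b _ => dimerCoeff_eq_ofReal (N := N) (n₀ b : ℕ), ← Complex.ofReal_prod, Complex.zero_lt_real]
  exact Finset.prod_pos fun b _ => dimerCoeffR_pos _

open scoped ComplexOrder in
/-- `Z(m = 0) ≠ 0` under the same hypothesis. [cite: FrommForcrand2008, (6)–(7)] -/
theorem fermiZSU_zero_ne_zero_of_saturating (hN : Odd N) (l : B → Λ × Λ) (hl : ∀ b, (l b).1 ≠ (l b).2)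
    (Γ : B → ℂ) (hΓ : ∀ b, Γ b = 1 ∨ Γ b = -1) (n₀ : B → Fin N) (h₀ : ∀ y, siteDeg l n₀ y = N) :
    fermiZSU (N := N) l Γ 0 ≠ 0 := by
  intro h
  have := sgn_mul_fermiZSU_zero_pos_of_saturating hN l hl Γ hΓ n₀ h₀
  rw [h, mul_zero] at this
  exact lt_irrefl _ this

open scoped ComplexOrder in
/-- **`∑_{y∼x} ⟨ψ̄ψ(x)ψ̄ψ(y)⟩_Λ ≥ 4N` UNCONDITIONALLY** (`SU(N)`, `N` odd `≥ 3`, `β = 0`, `m = 0`, simple bipartite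
link set with `Γ = ±1` admitting a saturating configuration). [cite: SalmhoferSeiler1991, Lemma 4.7 (4.38) & §5 p. 424] [cite: FrommForcrand2008, (5)–(7)] -/
theorem sum_nbr_fermiExpectSU_ge_of_saturating (hN : Odd N) (h3 : 3 ≤ N) (l : B → Λ × Λ) (hl : ∀ b, (l b).1 ≠ (l b).2)
    (hsimp : ∀ b b', Joins l b' (l b).1 (l b).2 → b' = b) (ε : Λ → Bool) (hε : ∀ b, ε (l b).1 ≠ ε (l b).2)
    (Γ : B → ℂ) (hΓ : ∀ b, Γ b = 1 ∨ Γ b = -1) (n₀ : B → Fin N) (h₀ : ∀ y, siteDeg l n₀ y = N) (x : Λ) :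
    4 * (N : ℂ) ≤ ∑ b ∈ Finset.univ.filter (fun b => (l b).1 = x ∨ (l b).2 = x),
        fermiExpectSU l Γ 0 (fun _ => (meson (l b).1 * meson (l b).2 : FermiAlg Λ N)) :=
  sum_nbr_fermiExpectSU_ge hN h3 l hl hsimp ε hε Γ hΓ x (fermiZSU_zero_ne_zero_of_saturating hN l hl Γ hΓ n₀ h₀)

end Saturating

/-! ### The staggered even torus: simple, bipartite, saturable — the bound for `SU(N)` on `(ℤ/Lℤ)^ν` -/

section TorusSU

open Literature.Probability.LatticeModels (TorusSite)
open Literature.MathematicalPhysics.StatisticalMechanics (ComplexSpin.parity ComplexSpin.parity_add_single)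

variable {ν L : ℕ} [NeZero L] [LinearOrder (TorusSite ν L)] {N : ℕ}

omit [NeZero L] [LinearOrder (TorusSite ν L)] in
/-- **The torus link set is simple for `L ≥ 3`** (for `L = 2` the links `(x, x+e_μ)` and `(x+e_μ, x)` are
distinct with the same endpoints). [cite: SalmhoferSeiler1991, §2 (2.1)–(2.3)] -/
theorem torusLinks_simple (hL : 3 ≤ L) (b b' : TorusSite ν L × Fin ν)
    (h : Joins (torusLinks ν L) b' (torusLinks ν L b).1 (torusLinks ν L b).2) : b' = b := by
  haveI : Fact (1 < L) := ⟨by omega⟩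
  obtain ⟨x, μ⟩ := b
  obtain ⟨y, μ'⟩ := b'
  have hsingle : ∀ μ₁ μ₂ : Fin ν, (Pi.single μ₁ (1 : ZMod L) : TorusSite ν L) μ₂ = if μ₂ = μ₁ then 1 else 0 :=
    fun μ₁ μ₂ => by rw [Pi.single_apply]
  rcases h with ⟨h1, h2⟩ | ⟨h1, h2⟩ <;> dsimp only [torusLinks] at h1 h2
  · subst h1
    have he : (Pi.single μ' (1 : ZMod L) : TorusSite ν L) = Pi.single μ 1 := add_left_cancel h2
    have hμ : μ' = μ := by
      by_contra hne
      have := congrFun he μ'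
      rw [hsingle, hsingle, if_pos rfl, if_neg hne] at this
      exact one_ne_zero this
    rw [hμ]
  · exfalso
    have he : (Pi.single μ (1 : ZMod L) : TorusSite ν L) + Pi.single μ' 1 = 0 := by
      have := h2; rw [h1, add_assoc] at this
      exact add_eq_left.1 this
    have hμ := congrFun he μ
    rw [Pi.add_apply, hsingle, hsingle, if_pos rfl, Pi.zero_apply] at hμ
    by_cases hm : μ = μ'
    · rw [if_pos hm] at hμ
      have h2' : ((2 : ℕ) : ZMod L) = 0 := by rw [Nat.cast_two, ← hμ]; ring
      rw [ZMod.natCast_eq_zero_iff] at h2'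
      have := Nat.le_of_dvd (by norm_num) h2'
      omega
    · rw [if_neg hm, add_zero] at hμ
      exact one_ne_zero hμ

omit [NeZero L] [LinearOrder (TorusSite ν L)] in
/-- **The even torus is bipartite** with the site parity `∑_j y_j mod 2` as colouring. [cite: SalmhoferSeiler1991, §2 (2.4) & (3.93)] -/
theorem torusLinks_bipartite (hL : 2 ∣ L) (b : TorusSite ν L × Fin ν) :
    (decide (ComplexSpin.parity hL (torusLinks ν L b).1 = 0)) ≠ decide (ComplexSpin.parity hL (torusLinks ν L b).2 = 0) := by
  have key : ∀ p : ZMod 2, decide (p = 0) ≠ decide (p + 1 = 0) := by decide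
  simp only [torusLinks, ComplexSpin.parity_add_single]
  exact key _


omit [NeZero L] [LinearOrder (TorusSite ν L)] in
/-- On the torus, `y - e_μ + e_μ = y` identifies the link arriving at `y` in direction `μ`. [cite: SalmhoferSeiler1991, §2 (2.3)] -/
theorem torusLinks_sub_single (y : TorusSite ν L) (μ : Fin ν) :
    torusLinks ν L (y - Pi.single μ 1, μ) = (y - Pi.single μ 1, y) := by
  simp [torusLinks]

/-- **The dimer degree of a site on the torus**: `d_n(y) = ∑_μ n(y, μ) + ∑_μ n(y - e_μ, μ)`. [cite: FrommForcrand2008, (6)] [cite: SalmhoferSeiler1991, §2 (2.3)] -/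
theorem siteDeg_torusLinks (n : TorusSite ν L × Fin ν → Fin N) (y : TorusSite ν L) :
    siteDeg (torusLinks ν L) n y = ∑ μ, (n (y, μ) : ℕ) + ∑ μ, (n (y - Pi.single μ 1, μ) : ℕ) := by
  unfold siteDeg
  congr 1
  · refine Finset.sum_nbij' (fun b => b.2) (fun μ => (y, μ)) (fun b _ => Finset.mem_univ _) (fun μ _ => ?_) (fun b hb => ?_)
      (fun μ _ => rfl) (fun b hb => ?_)
    · simp only [Finset.mem_filter, Finset.mem_univ, true_and, torusLinks]
    · simp only [Finset.mem_filter, Finset.mem_univ, true_and, torusLinks] at hb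
      exact Prod.ext hb.symm rfl
    · simp only [Finset.mem_filter, Finset.mem_univ, true_and, torusLinks] at hb
      rw [← hb]
  · refine Finset.sum_nbij' (fun b => b.2) (fun μ => (y - Pi.single μ 1, μ)) (fun b _ => Finset.mem_univ _) (fun μ _ => ?_)
      (fun b hb => ?_) (fun μ _ => rfl) (fun b hb => ?_)
    · simp only [Finset.mem_filter, Finset.mem_univ, true_and, torusLinks, sub_add_cancel]
    · simp only [Finset.mem_filter, Finset.mem_univ, true_and, torusLinks] at hb
      exact Prod.ext (eq_sub_of_add_eq hb).symm rfl
    · simp only [Finset.mem_filter, Finset.mem_univ, true_and, torusLinks] at hb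
      have hb1 : b.1 = y - Pi.single b.2 1 := eq_sub_of_add_eq hb
      rw [← hb1]

/-- **The even torus admits a configuration saturating every site**: `N-1` partial dimers on the
links `(y, y+e_0)` with `y` even and `1` on those with `y` odd (`ν ≥ 1`, `L` even, `N ≥ 2`). [cite: FrommForcrand2008, (6)] -/
theorem exists_saturating_torusLinks (h1 : 1 < N) (hν : 0 < ν) (hL : 2 ∣ L) :
    ∃ n₀ : TorusSite ν L × Fin ν → Fin N, ∀ y, siteDeg (torusLinks ν L) n₀ y = N := by
  set μ₀ : Fin ν := ⟨0, hν⟩ with hμ₀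
  set v : TorusSite ν L → ℕ := fun y => if ComplexSpin.parity hL y = 0 then N - 1 else 1 with hv
  have hvlt : ∀ y, v y < N := fun y => by rw [hv]; dsimp only; split_ifs <;> omega
  refine ⟨fun b => ⟨if b.2 = μ₀ then v b.1 else 0, by split_ifs; exacts [hvlt _, by omega]⟩, fun y => ?_⟩
  rw [siteDeg_torusLinks]
  simp only [Finset.sum_ite_eq', Finset.mem_univ, if_true]
  have hpar : ComplexSpin.parity hL (y - Pi.single μ₀ 1) = ComplexSpin.parity hL y + 1 := by
    have h := ComplexSpin.parity_add_single hL (y - Pi.single μ₀ 1) μ₀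
    rw [sub_add_cancel] at h
    have hneg : ∀ p : ZMod 2, (p + 1) + 1 = p := by decide
    rw [h, hneg]
  rw [hv]; dsimp only; rw [hpar]
  have hcases : ∀ p : ZMod 2, p = 0 ∨ p = 1 := by decide
  rcases hcases (ComplexSpin.parity hL y) with hp | hp
  · rw [hp, if_pos rfl, if_neg (by decide)]; omega
  · rw [hp, if_neg (by decide), if_pos (by decide)]; omega

open scoped ComplexOrder in
/-- **`Z > 0` for `SU(N)` (`N` odd `≥ 3`... indeed any odd `N ≥ 2`), `β = 0`, `m = 0`, on the staggered torus
`(ℤ/Lℤ)^ν`** (`ν ≥ 1`, `L` even, any sign twists `Γ_b = ±1`). [cite: FrommForcrand2008, (6)–(7)] [cite: SalmhoferSeiler1991, §2 (2.9)] -/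
theorem sgn_mul_fermiZSU_zero_pos_torus (hN : Odd N) (h1 : 1 < N) (hν : 0 < ν) (hL : 2 ∣ L) (hL1 : 1 < L)
    (Γ : TorusSite ν L × Fin ν → ℂ) (hΓ : ∀ b, Γ b = 1 ∨ Γ b = -1) :
    0 < sgn (Fintype.card (CIdx (TorusSite ν L) N)) * fermiZSU (N := N) (torusLinks ν L) Γ 0 := by
  obtain ⟨n₀, h₀⟩ := exists_saturating_torusLinks (N := N) h1 hν hL
  exact sgn_mul_fermiZSU_zero_pos_of_saturating hN _ (torusLinks_ne hL1) Γ hΓ n₀ h₀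

open scoped ComplexOrder in
/-- **THE SCHWINGER–DYSON BOUND FOR `SU(N)` ON THE STAGGERED TORUS**: for `N` odd `≥ 3`, `β = 0`, `m = 0`, one
staggered flavour on `(ℤ/Lℤ)^ν` (`ν ≥ 1`, `L` even `≥ 4`, any sign twists `Γ_b = ±1` — staggered phases times
boundary-condition signs), and every site `x`,

  `∑_{b ∋ x} ⟨ψ̄ψ(x_b) ψ̄ψ(y_b)⟩_Λ ≥ 4N`,   i.e. `∑_{y∼x} ⟨σ_x σ_y⟩_Λ ≥ 1/N` in Salmhofer–Seiler's units

— the Schwinger–Dyson input of their Theorem 4.8 for `SU(N)`.  Honest framing: `β = 0`, finite volume;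
nothing about `β > 0`, the infrared bound, the thermodynamic limit or the continuum; false for `SU(2)`. [cite: SalmhoferSeiler1991, Lemma 4.7 (4.38), Thm 4.8 & §5 p. 424] [cite: FrommForcrand2008, (5)–(7)] -/
theorem sum_nbr_fermiExpectSU_ge_torus (hN : Odd N) (h3 : 3 ≤ N) (hν : 0 < ν) (hL : 2 ∣ L) (hL3 : 3 ≤ L)
    (Γ : TorusSite ν L × Fin ν → ℂ) (hΓ : ∀ b, Γ b = 1 ∨ Γ b = -1) (x : TorusSite ν L) :
    4 * (N : ℂ) ≤ ∑ b ∈ Finset.univ.filter (fun b => (torusLinks ν L b).1 = x ∨ (torusLinks ν L b).2 = x),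
        fermiExpectSU (torusLinks ν L) Γ 0
          (fun _ => (meson (torusLinks ν L b).1 * meson (torusLinks ν L b).2 : FermiAlg (TorusSite ν L) N)) := by
  obtain ⟨n₀, h₀⟩ := exists_saturating_torusLinks (N := N) (by omega) hν hL
  convert sum_nbr_fermiExpectSU_ge_of_saturating hN h3 _ (torusLinks_ne (by omega)) (torusLinks_simple hL3)
    (fun y => decide (ComplexSpin.parity hL y = 0)) (torusLinks_bipartite hL) Γ hΓ n₀ h₀ x

end TorusSU

end StrongCoupling

end Literature.MathematicalPhysics.QuantumLattice
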